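import Literature.MathematicalPhysics.QuantumLattice.HubbardTTPrimeMeanEnergySupergradient
import Literature.MathematicalPhysics.QuantumLattice.HubbardTTPrimeFreeKineticBound
import Literature.MathematicalPhysics.QuantumLattice.HubbardSquareFreeFermionEnergyDensity
import Literature.MathematicalPhysics.QuantumLattice.HubbardEnergyDensityChemicalPotential
import Literature.MathematicalPhysics.QuantumLattice.TorusLimitOfMixtures
import HarnessLib

/-!
# Kinematic ("K-") rows: the one-body hopping energies per site of every torus-limit state are
# bounded by the half-filled free band, `|K₁(ω)| ≤ 16/π²`

Family `hubbard` (topic `MathematicalPhysics/QuantumLattice`; companion of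
`HubbardTTPrimeCapCutDualRows` and `HubbardTTPrimeMeanEnergySupergradient`). Written for the certified
fast layer of the Hubbard re-charter (crew hubbard-fast): planner-p2 asked the engine (2026-08-25) to add
to every moment program the UNIVERSAL rows `HOP1 ≤ 16/π²`, `-HOP1 ≤ 16/π²` ("max over ALL states of the
nearest-neighbour hopping density per site = the half-filled free-band value"), with the outward decimal
`16/π² < 1.6211390`, and planner-p1's program-free "LAYER 0b" LP over the three energy coordinates
`(K₁, K₂, D)` of a state uses the same "kinematic ranges". This file is the KERNEL form of those rows for
the states the cell's certificates speak about (torus limits of unit fixed-density vectors, ground states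
or not). Everything is PROVED; no definition, no named fact, no numerical input.

Notation: for an infinite-volume state `ω` on `ℤ²`, `K₁(ω) := e_{Φ(1,0,0)}(ω)`
(`ω.meanEnergy (hubbardTTPrimeFermionInteraction 1 0 0) 1`) is the mean energy per site of the unit
nearest-neighbour hopping interaction, `K₂(ω) := e_{Φ(0,1,0)}(ω)` that of the unit diagonal
(next-nearest-neighbour) hopping, `D(ω) := e_{Φ(0,0,1)}(ω)` the double-occupancy density
(`HubbardTTPrimeCapCutDualRows` §1). In the engine's dictionary `HOP1 = -K₁`, `HOP2 = -K₂`.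

## Content

* §1 **The half-filled free value is the floor of the whole repulsive family**: for `U ≥ 0`,
  `0 ≤ n < 2`, every `t`: `e(t, 0, 1) = -16|t|/π² ≤ e(t, U, n)`
  (`energyDensity2D_zero_one_le`, `neg_sixteen_mul_abs_div_pi_sq_le_energyDensity2D`, and the `t–t'`
  vocabulary form `neg_sixteen_mul_abs_div_pi_sq_le_energyDensityTT'`). Proof: the tree's Lieb–Loss
  bathtub bound `FreeKinetic.energyDensity2D_ge` at chemical potential `μ = 0` is
  `2(2π)⁻² ∫ min(ε, 0)`, which is the half-filled free value `FreeFermionSquare.energyDensity2D_zero_one`.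
* §2 **K₁ rows.** If `ω` is the torus limit of unit `rectN n (Ls j)`-particle vectors (`0 ≤ n < 2`;
  no ground-state hypothesis), then `-16/π² ≤ K₁(ω) ≤ 16/π²`
  (`IsTorusLimitOf.neg_sixteen_div_pi_sq_le_meanEnergy_nnHop`, `…meanEnergy_nnHop_le_sixteen_div_pi_sq`,
  `…abs_meanEnergy_nnHop_le`; general amplitude `…abs_meanEnergy_hop_le`: `|e_{Φ(t,0,0)}(ω)| ≤ 16|t|/π²`).
  Proof: the variational inequality at the couplings `(±1, 0, 0)`
  (`IsTorusLimitOf.energyDensityTT'_le_meanEnergy_hubbardTTPrime`: `e(±1,0,0,n) ≤ e_{Φ(±1,0,0)}(ω) = ±K₁(ω)`)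
  and §1. The engine's outward decimal: `|K₁(ω)| ≤ 1.6211390` (`…abs_meanEnergy_nnHop_le_decimal`, from
  Mathlib's `Real.pi_gt_d20`; the comparison `16/π² < 1.6211390` is a private helper).
* §3 **The `t–t'` Fermi sea in the thermodynamic limit, the diagonal band and the K₂ rows.** For
  `U ≥ 0`, `0 ≤ n < 2`, all `t, t', μ`: `μn + 2(2π)⁻² ∫ min(ε(p) − μ, 0) dp ≤ e(t, t', U, n)`,
  `ε(p) = 2t(cos p₁ + cos p₂) − 4t' cos p₁ cos p₂` (`energyDensityTT'_ge_bathtub`, the `t' ≠ 0` twin of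
  the tree's `FreeKinetic.energyDensity2D_ge`; the band is written at the grid-cell corners, i.e. shifted
  by `(π,π)` — same Fermi sea). In particular
  `-16|t'|/π² ≤ e(0, t', U, n)` (`neg_sixteen_mul_abs_div_pi_sq_le_energyDensityTT'_diag`): the
  next-nearest-neighbour band `-4t' cos p₁ cos p₂` filled to its Fermi sea at chemical potential `0` has
  energy `2(2π)⁻² ∫_{[-π,π]²} min(-4t' cos p₁ cos p₂, 0) dp = -16|t'|/π²` per site — the SAME value as the
  nearest-neighbour band (`min(z, 0) = (z - |z|)/2`, `∫ cos = 0`, `∫_{-π}^{π} |cos| = 4`), obtained from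
  the tree's torus bathtub bound `TTPrimeFree.le_groundEnergy_hubbardTorusTT'` at `μ = 0` along the tori
  `L ≥ 3` and the convergence of corner Riemann sums (`tendsto_cornerRiemannSum`). Hence, for the same
  torus-limit states as in §2, `-16/π² ≤ K₂(ω) ≤ 16/π²` and `|K₂(ω)| ≤ 1.6211390`
  (`IsTorusLimitOf.neg_sixteen_div_pi_sq_le_meanEnergy_diagHop`, `…meanEnergy_diagHop_le_sixteen_div_pi_sq`,
  `…abs_meanEnergy_diagHop_le`, `…abs_meanEnergy_diagHop_le_decimal`): the engine's rows `±HOP2 ≤ 16/π²`.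

* §4 **D rows.** For every infinite-volume state: `0 ≤ Re ω(n_{0↑}n_{0↓}) ≤ Re ω(n_{0↓})`
  (`re_expect_docc_nonneg`, `re_expect_nAt_mul_nAt_le_down`; the tree had `≤ Re ω(n_{0↑})`); hence for
  `ω` the torus limit of unit `rectN n (Ls j)`-particle vectors:
  `max(0, n − 1) ≤ D(ω) ≤ n/2` (`IsTorusLimitOf.docc_nonneg`, `…docc_le_half_density`,
  `…density_sub_one_le_docc`) — the LP's `D ≥ 0` row and the two density kinematic rows, no
  `S^z`-sector hypothesis (`D ≤ min(n↑, n↓) ≤ n/2`).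
* §5 **The same rows for MIXTURE (e.g. thermal) torus limits.** Every row of §2–§4 holds verbatim for
  `ω` a torus limit of finite MIXTURES (`InfVolFermionState.IsTorusLimitOfMixture`, weights `p ≥ 0`,
  `Σ_i p_{L,i} = 1`) of unit `rectN n L`-particle vectors — in particular for torus limits of the
  canonical Gibbs states `e^{-βH_L}/Z` on the sectors `rectN n L` at any temperature (the states of
  planner-p2's thermal `N2′` row): the density of such a limit is `n`
  (`IsTorusLimitOfMixture.density_eq`, `…density_eq_of_rectN`: the averaged local density of each
  component is exactly `N/L^d`, `torusAvgExpect_nAt_add_nAt`, and the weights sum to one), and the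
  K-rows follow from the mixture variational inequality
  `IsTorusLimitOfMixture.energyDensityTT'_le_meanEnergy_hubbardTTPrime` exactly as in §2–§3
  (`IsTorusLimitOfMixture.neg_sixteen_div_pi_sq_le_meanEnergy_nnHop`, `…meanEnergy_nnHop_le_sixteen_div_pi_sq`,
  `…abs_meanEnergy_nnHop_le[_decimal]`, `…abs_meanEnergy_hop_le`, `…neg_sixteen_div_pi_sq_le_meanEnergy_diagHop`,
  `…meanEnergy_diagHop_le_sixteen_div_pi_sq`, `…abs_meanEnergy_diagHop_le[_decimal]`,
  `…abs_meanEnergy_diagHop_smul_le`, `…docc_nonneg`, `…docc_le_half_density`, `…density_sub_one_le_docc`).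

* §6 **Fermi-sea corner-sum rows** (planner-p2's `bathtub-corner/1` certificates, 2026-08-25): for
  `2|t'| ≤ t`, `U ≥ 0`, `0 ≤ n < 2`, `M ≥ 1`, numbers `cos(iπ/M) ≤ uᵢ ≤ 1` (`i < M`) and every `μ`,
  `μ n + 2 M⁻² Σ_{i,j<M} min(-2t(uᵢ + uⱼ) - 4t' uᵢ uⱼ - μ, 0) ≤ e(t, t', U, n)`
  (`energyDensityTT'_ge_fermiSea_cornerSum`; `t = 1`, `|t'| ≤ 1/2`:
  `energyDensityTT'_one_ge_fermiSea_cornerSum`) — the certified Riemann MINORANT of the bathtub integral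
  of §3 on the uniform `2M × 2M` grid of `[-π,π]²`: the band is monotone in each cosine when `2|t'| ≤ t`,
  so on each cell the integrand is bounded below by its value at the cell's extreme cosines, and those
  are bounded by the user's table `uᵢ ≥ cos(iπ/M)` (folded cell index; each `i < M` is hit twice).
  The table (rational upper bounds of `cos(iπ/M)`) and the evaluation of the finite double sum are the
  certificate's business; this file proves that ANY such table gives a valid lower bound of `e`.
* §6b **Cell-exact Fermi-sea rows** (`energyDensityTT'_ge_fermiSea_cellSum`, `t = 1` form
  `energyDensityTT'_one_ge_fermiSea_cellSum`): the same grid, but every cell certified to lie INSIDE the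
  Fermi sea (`-2t(wᵢ + wⱼ) - 4t' wᵢ wⱼ ≤ μ` for lower bounds `wᵢ ≤ cos((i+1)π/M)`) contributes its EXACT
  integral `-2tΔ(Sᵢ + Sⱼ) - 4t' SᵢSⱼ - μΔ²` (`Sᵢ = sin((i+1)π/M) - sin(iπ/M)`, `Δ = π/M`) instead of
  the corner value: `μ n + (2/π²) Σ_{i,j<M} cᵢⱼ ≤ e(t, t', U, n)`. Only the `O(M)` cells met by the Fermi
  surface keep a first-order error, so the bound is second-order sharp (`M = 128` beats the `M = 4000`
  corner sum); the sine/π enclosures are again the certificate's business.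

How the rows are USED (not formalised here, recorded for the reader): in a Tier-1 / LAYER-0b LP or in a
moment program at `(t, t', U)`, `HOP1 ≤ 16/π²` is the CUT row of `InfVolFermionState.capCuts_dual_le`
at the anchor `(t'_k, U_k) = (0, 0)` with the certified value `lo_k = -16|t|/π² ≤ e(t, 0, 0, n)` (§1);
the reverse row `-HOP1 ≤ 16/π²` is NOT of cut shape (it is the cut at hopping `-t`) and is supplied by
§2 directly.

## Mathlib / tree search

REUSED: `FreeKinetic.energyDensity2D_ge` (bathtub, every `μ`), `FreeFermionSquare.energyDensity2D_zero_one`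
(`e(t,0,1) = -16|t|/π²`), `FreeFermionSquare.energyDensity2D_zero_one_eq_integral`,
`ThermodynamicLimit.energyDensityTT'_zero` (`e(t,0,U,n) = energyDensity2D t U n`),
`TTPrimeFree.le_groundEnergy_hubbardTorusTT'` + `TTPrimeFree.ttBand` (torus bathtub for the `t–t'` band),
`ThermodynamicLimit.tendsto_energyDensityTT'_torus`, `tendsto_cornerRiemannSum`, `HartreeFock.sum_cellCorner_div_eq`,
`IsTorusLimitOf.energyDensityTT'_le_meanEnergy_hubbardTTPrime`, `InfVolFermionState.meanEnergy_hubbardTTPrime_smul`,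
`Real.pi_gt_d20`, `integral_cos`, `Real.cos_nonneg_of_mem_Icc`, `Real.cos_nonpos_of_pi_div_two_le_of_le`,
`MeasureTheory.volume_preserving_finTwoArrow` (the Brillouin-square plumbing is copied from the private
helpers of `HubbardSquareFreeFermionEnergyDensity` §4); for §4 `InfVolFermionState.re_expect_nAt_mul_nAt_le`,
`re_expect_nAt_add_sub_one_le`, `re_expect_nonneg_of_isHermitian_of_isIdempotentElem`,
`isHermitian_isIdempotentElem_mul_of_commute`, `IsTorusLimitOf.density_eq_of_rectN`,
`IsTorusLimitOf.meanEnergy_onSite_eq_re_expect_docc` (`HubbardEnergyDensityChemicalPotential`,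
`InfVolFermionStateDensity`, `HubbardTTPrimeMeanEnergySupergradient`); for §5
`IsTorusLimitOfMixture.energyDensityTT'_le_meanEnergy_hubbardTTPrime`,
`IsTorusLimitOfMixture.meanEnergy_onSite_eq_re_expect_docc`, `torusAvgExpect_nAt_add_nAt`,
`ThermodynamicLimit.tendsto_rectN_div_sq` (`TorusLimitOfMixtures`, `InfVolFermionStateDensity`).
`lean search '16 / π ^ 2|kinematic|meanEnergy_nnHop'` in Literature: only the `U = 0`, `n = 1` VALUE
(`HubbardSquareFreeFermionEnergyDensity`); no state-wise hopping bound. For §6: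
`intervalIntegral.sum_integral_adjacent_intervals`, `intervalIntegral.integral_mono_on`,
`intervalIntegral.continuous_parametric_intervalIntegral_of_continuous'`, `Real.cos_le_cos_of_nonneg_of_le_pi`,
`Real.cos_add_pi`, `Real.cos_pi_sub`, `Finset.sum_range_reflect`; `lean search 'Riemann minorant|lower
Riemann sum|cornerSum'`: only the CONVERGENCE of corner Riemann sums (`BrillouinRiemannSum`), no one-sided
grid bound for monotone integrands.

## References

* E. H. Lieb, M. Loss, Duke Math. J. 71 (1993) 337, §8, Theorem 8.2 (the sum of the negative
  eigenvalues bounds the one-body energy of every fermion state). [cite: LiebLoss1993, §8, Theorem 8.2]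
* J. E. Hirsch, Phys. Rev. B 31 (1985) 4403, §II eq. (2.2) (`ε_k = -2t(cos k_x + cos k_y)`, the
  half-filled Fermi sea). [cite: Hirsch1985, §II, eq. (2.2)]
* D. Ruelle, *Statistical Mechanics* (1969), §3.4 (variational characterisation of the ground-state
  energy density: every fixed-density state is a trial state). [cite: Ruelle1969, §3.4]
* O. Bratteli, A. Kishimoto, D. W. Robinson, Commun. Math. Phys. 64 (1978) 41, §3 (mean energy is
  linear in the interaction). [cite: BratteliKishimotoRobinson1978, §3 (mean energy functional)]
* O. Bratteli, D. W. Robinson, *Operator Algebras and Quantum Statistical Mechanics I* (2nd ed., 1987),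
  §2.3.2 (states: positivity, `0 ≤ ω(P) ≤ 1` for projections). [cite: BratteliRobinsonI1987, §2.3.2]
* H. Araki, H. Moriya, Rev. Math. Phys. 15 (2003) 93, §4.1 (densities of states on the CAR algebra).
  [cite: ArakiMoriya2003, §4.1]
-/

noncomputable section

namespace Literature.MathematicalPhysics.QuantumLattice

open Matrix Finset HubbardWave0 Literature.Probability.LatticeModels ThermodynamicLimit
open _root_.Filter
open scoped _root_.Topology ComplexOrder BigOperators

/-! ### §1 The half-filled free band is the floor of the repulsive family -/

/-- **`e(t, 0, 1) ≤ e(t, U, n)`** for `U ≥ 0`, `0 ≤ n < 2`: the half-filled free Fermi sea (all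
negative plane-wave levels filled, no repulsion) has the least energy per site of the whole repulsive
square-lattice family — the Lieb–Loss bathtub bound at chemical potential `0`.
[cite: LiebLoss1993, §8, Theorem 8.2] -/
theorem energyDensity2D_zero_one_le (t : ℝ) {U : ℝ} (hU : 0 ≤ U) {n : ℝ} (hn0 : 0 ≤ n)
    (hn2 : n < 2) : energyDensity2D t 0 1 ≤ energyDensity2D t U n := by
  have h := FreeKinetic.energyDensity2D_ge t hU hn0 hn2 0
  simp only [zero_mul, zero_add, sub_zero] at h
  rwa [← FreeFermionSquare.energyDensity2D_zero_one_eq_integral t] at h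

/-- **`-16|t|/π² ≤ e(t, U, n)`** for `U ≥ 0`, `0 ≤ n < 2` (the half-filled free value in closed form,
Hirsch's filled negative-energy plane waves). [cite: Hirsch1985, §II, eq. (2.2)]
[cite: LiebLoss1993, §8, Theorem 8.2] -/
theorem neg_sixteen_mul_abs_div_pi_sq_le_energyDensity2D (t : ℝ) {U : ℝ} (hU : 0 ≤ U) {n : ℝ}
    (hn0 : 0 ≤ n) (hn2 : n < 2) : -(16 * |t|) / Real.pi ^ 2 ≤ energyDensity2D t U n := by
  rw [← FreeFermionSquare.energyDensity2D_zero_one t]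
  exact energyDensity2D_zero_one_le t hU hn0 hn2

/-- The same floor in the `t–t'` vocabulary: `-16|t|/π² ≤ e(t, 0, U, n)` (`U ≥ 0`, `0 ≤ n < 2`) — a
certified lower bound at the anchor `(t', U) = (0, U)` valid at EVERY density, i.e. the value `lo` of
the kinematic cut row. [cite: LiebLoss1993, §8, Theorem 8.2] -/
theorem neg_sixteen_mul_abs_div_pi_sq_le_energyDensityTT' (t : ℝ) {U : ℝ} (hU : 0 ≤ U) {n : ℝ}
    (hn0 : 0 ≤ n) (hn2 : n < 2) : -(16 * |t|) / Real.pi ^ 2 ≤ energyDensityTT' t 0 U n := by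
  rw [energyDensityTT'_zero]
  exact neg_sixteen_mul_abs_div_pi_sq_le_energyDensity2D t hU hn0 hn2

/-- Numerical form of the constant: `16/π² < 1.6211390` (`π > 3.14159265358979323846`); the engine's
outward 7-digit decimal. [folklore] -/
private theorem sixteen_div_pi_sq_lt_decimal : 16 / Real.pi ^ 2 < (1.6211390 : ℝ) := by
  have hπ : (3.14159265358979323846 : ℝ) < Real.pi := Real.pi_gt_d20
  have hpos : (0 : ℝ) < Real.pi ^ 2 := by positivity
  have hsq : (9.869604401 : ℝ) < Real.pi ^ 2 := by nlinarith
  rw [div_lt_iff₀ hpos]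
  nlinarith

/-! ### §2 K₁ rows: the nearest-neighbour hopping energy per site of a torus-limit state -/

namespace InfVolFermionState

/-- **Lower K₁ row** (`HOP1 ≤ 16/π²` in the engine's sign): if `ω` is the torus limit along `Ls → ∞`
of unit `rectN n (Ls j)`-particle vectors (`0 ≤ n < 2`; ground states or not), then
`-16/π² ≤ K₁(ω) = e_{Φ(1,0,0)}(ω)` — the variational inequality at the coupling `(1, 0, 0)` and the
half-filled free floor. [cite: LiebLoss1993, §8, Theorem 8.2] [cite: Ruelle1969, §3.4] -/
theorem IsTorusLimitOf.neg_sixteen_div_pi_sq_le_meanEnergy_nnHop {n : ℝ} (hn0 : 0 ≤ n) (hn2 : n < 2)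
    {ω : InfVolFermionState 2} {ψ : ∀ L, Fock (Orb (FermionTorus 2 L))} {Ls : ℕ → ℕ}
    (h : ω.IsTorusLimitOf ψ Ls) (hLs : Tendsto Ls atTop atTop)
    (hN : ∀ j, IsNParticle (rectN n (Ls j)) (ψ (Ls j)))
    (h1 : ∀ j, star (ψ (Ls j)) ⬝ᵥ ψ (Ls j) = 1) :
    -16 / Real.pi ^ 2 ≤ ω.meanEnergy (hubbardTTPrimeFermionInteraction 1 0 0) 1 := by
  have hvar := h.energyDensityTT'_le_meanEnergy_hubbardTTPrime 1 0 le_rfl hn0 hn2 hLs hN h1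
  have hfloor := neg_sixteen_mul_abs_div_pi_sq_le_energyDensityTT' 1 le_rfl hn0 hn2
  rw [abs_one, mul_one] at hfloor
  exact hfloor.trans hvar

/-- **Upper K₁ row** (`-HOP1 ≤ 16/π²`): same states, `K₁(ω) ≤ 16/π²` — the variational inequality at
the coupling `(-1, 0, 0)` (`e_{Φ(-1,0,0)}(ω) = -K₁(ω)`) and the half-filled free floor at hopping `-1`.
[cite: LiebLoss1993, §8, Theorem 8.2] [cite: Ruelle1969, §3.4] -/
theorem IsTorusLimitOf.meanEnergy_nnHop_le_sixteen_div_pi_sq {n : ℝ} (hn0 : 0 ≤ n) (hn2 : n < 2)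
    {ω : InfVolFermionState 2} {ψ : ∀ L, Fock (Orb (FermionTorus 2 L))} {Ls : ℕ → ℕ}
    (h : ω.IsTorusLimitOf ψ Ls) (hLs : Tendsto Ls atTop atTop)
    (hN : ∀ j, IsNParticle (rectN n (Ls j)) (ψ (Ls j)))
    (h1 : ∀ j, star (ψ (Ls j)) ⬝ᵥ ψ (Ls j) = 1) :
    ω.meanEnergy (hubbardTTPrimeFermionInteraction 1 0 0) 1 ≤ 16 / Real.pi ^ 2 := by
  have hvar := h.energyDensityTT'_le_meanEnergy_hubbardTTPrime (-1) 0 le_rfl hn0 hn2 hLs hN h1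
  have hfloor := neg_sixteen_mul_abs_div_pi_sq_le_energyDensityTT' (-1) le_rfl hn0 hn2
  rw [abs_neg, abs_one, mul_one] at hfloor
  have hsm : ω.meanEnergy (hubbardTTPrimeFermionInteraction (-1) 0 0) 1 =
      -1 * ω.meanEnergy (hubbardTTPrimeFermionInteraction 1 0 0) 1 := by
    have hs := ω.meanEnergy_hubbardTTPrime_smul (-1) 1 0 0
    rwa [mul_one, mul_zero] at hs
  rw [hsm] at hvar
  have := hfloor.trans hvar
  rw [neg_div] at this
  linarith

/-- **`|K₁(ω)| ≤ 16/π²`** for every torus limit of unit fixed-density vectors: the nearest-neighbour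
hopping energy per site of any such state lies in the range of the free band filled to half filling
(both signs by the bipartite symmetry `t ↦ -t`). [cite: LiebLoss1993, §8, Theorem 8.2] -/
theorem IsTorusLimitOf.abs_meanEnergy_nnHop_le {n : ℝ} (hn0 : 0 ≤ n) (hn2 : n < 2)
    {ω : InfVolFermionState 2} {ψ : ∀ L, Fock (Orb (FermionTorus 2 L))} {Ls : ℕ → ℕ}
    (h : ω.IsTorusLimitOf ψ Ls) (hLs : Tendsto Ls atTop atTop)
    (hN : ∀ j, IsNParticle (rectN n (Ls j)) (ψ (Ls j)))
    (h1 : ∀ j, star (ψ (Ls j)) ⬝ᵥ ψ (Ls j) = 1) :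
    |ω.meanEnergy (hubbardTTPrimeFermionInteraction 1 0 0) 1| ≤ 16 / Real.pi ^ 2 :=
  abs_le.2 ⟨by simpa only [neg_div] using h.neg_sixteen_div_pi_sq_le_meanEnergy_nnHop hn0 hn2 hLs hN h1,
    h.meanEnergy_nnHop_le_sixteen_div_pi_sq hn0 hn2 hLs hN h1⟩

/-- General amplitude: `|e_{Φ(t,0,0)}(ω)| ≤ 16|t|/π²` (`e_{Φ(t,0,0)} = t·K₁`).
[cite: LiebLoss1993, §8, Theorem 8.2] -/
theorem IsTorusLimitOf.abs_meanEnergy_hop_le (t : ℝ) {n : ℝ} (hn0 : 0 ≤ n) (hn2 : n < 2)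
    {ω : InfVolFermionState 2} {ψ : ∀ L, Fock (Orb (FermionTorus 2 L))} {Ls : ℕ → ℕ}
    (h : ω.IsTorusLimitOf ψ Ls) (hLs : Tendsto Ls atTop atTop)
    (hN : ∀ j, IsNParticle (rectN n (Ls j)) (ψ (Ls j)))
    (h1 : ∀ j, star (ψ (Ls j)) ⬝ᵥ ψ (Ls j) = 1) :
    |ω.meanEnergy (hubbardTTPrimeFermionInteraction t 0 0) 1| ≤ 16 * |t| / Real.pi ^ 2 := by
  have hsm : ω.meanEnergy (hubbardTTPrimeFermionInteraction t 0 0) 1 =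
      t * ω.meanEnergy (hubbardTTPrimeFermionInteraction 1 0 0) 1 := by
    have hs := ω.meanEnergy_hubbardTTPrime_smul t 1 0 0
    rwa [mul_one, mul_zero] at hs
  rw [hsm, abs_mul, mul_comm (16 : ℝ) |t|, mul_div_assoc]
  exact mul_le_mul_of_nonneg_left (h.abs_meanEnergy_nnHop_le hn0 hn2 hLs hN h1) (abs_nonneg t)

/-- **The engine's K₁ rows with their outward decimal**: `|K₁(ω)| ≤ 1.6211390`, i.e. both program rows
`HOP1 ≤ 16211390/10⁷` and `-HOP1 ≤ 16211390/10⁷` hold for every torus limit of unit fixed-density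
vectors. [cite: LiebLoss1993, §8, Theorem 8.2] -/
theorem IsTorusLimitOf.abs_meanEnergy_nnHop_le_decimal {n : ℝ} (hn0 : 0 ≤ n) (hn2 : n < 2)
    {ω : InfVolFermionState 2} {ψ : ∀ L, Fock (Orb (FermionTorus 2 L))} {Ls : ℕ → ℕ}
    (h : ω.IsTorusLimitOf ψ Ls) (hLs : Tendsto Ls atTop atTop)
    (hN : ∀ j, IsNParticle (rectN n (Ls j)) (ψ (Ls j)))
    (h1 : ∀ j, star (ψ (Ls j)) ⬝ᵥ ψ (Ls j) = 1) :
    |ω.meanEnergy (hubbardTTPrimeFermionInteraction 1 0 0) 1| ≤ (1.6211390 : ℝ) :=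
  (h.abs_meanEnergy_nnHop_le hn0 hn2 hLs hN h1).trans sixteen_div_pi_sq_lt_decimal.le

end InfVolFermionState

/-! ### §3 The diagonal band: `-16|t'|/π² ≤ e(0, t', U, n)`, and the K₂ rows -/

section DiagQuadrature

open Real Set MeasureTheory

/-- `∫_{-π}^{π} |cos y| dy = 4` (split at `∓π/2`). [folklore] -/
private theorem integral_abs_cos : ∫ y in (-π)..π, |Real.cos y| = 4 := by
  have hc : ∀ a b : ℝ, IntervalIntegrable (fun y => |Real.cos y|) volume a b := fun a b =>
    (continuous_abs.comp Real.continuous_cos).intervalIntegrable a b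
  have hπ := Real.pi_pos
  have h1 : ∫ y in (-π)..(-(π / 2)), |Real.cos y| = 1 := by
    rw [intervalIntegral.integral_congr (g := fun y => -Real.cos y) ?_]
    · rw [intervalIntegral.integral_neg, integral_cos, Real.sin_neg, Real.sin_neg, Real.sin_pi_div_two,
        Real.sin_pi]
      ring
    · intro y hy
      rw [Set.uIcc_of_le (by linarith)] at hy
      have hcos : Real.cos y ≤ 0 := by
        have h := Real.cos_nonpos_of_pi_div_two_le_of_le (x := -y) (by linarith [hy.2]) (by linarith [hy.1])
        rwa [Real.cos_neg] at h
      exact abs_of_nonpos hcos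
  have h2 : ∫ y in (-(π / 2))..(π / 2), |Real.cos y| = 2 := by
    rw [intervalIntegral.integral_congr (g := fun y => Real.cos y) ?_]
    · rw [integral_cos, Real.sin_neg, Real.sin_pi_div_two]
      ring
    · intro y hy
      rw [Set.uIcc_of_le (by linarith)] at hy
      exact abs_of_nonneg (Real.cos_nonneg_of_mem_Icc hy)
  have h3 : ∫ y in (π / 2)..π, |Real.cos y| = 1 := by
    rw [intervalIntegral.integral_congr (g := fun y => -Real.cos y) ?_]
    · rw [intervalIntegral.integral_neg, integral_cos, Real.sin_pi_div_two, Real.sin_pi]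
      ring
    · intro y hy
      rw [Set.uIcc_of_le (by linarith)] at hy
      exact abs_of_nonpos (Real.cos_nonpos_of_pi_div_two_le_of_le hy.1 (by linarith [hy.2]))
  rw [← intervalIntegral.integral_add_adjacent_intervals (hc (-π) (-(π / 2))) (hc (-(π / 2)) π),
    ← intervalIntegral.integral_add_adjacent_intervals (hc (-(π / 2)) (π / 2)) (hc (π / 2) π), h1, h2, h3]
  norm_num

/-- `min(z, 0) = (z - |z|)/2`. [folklore] -/
private theorem min_zero_eq_half (z : ℝ) : min z 0 = (z - |z|) / 2 := by
  rcases le_total z 0 with h | h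
  · rw [min_eq_left h, abs_of_nonpos h]; ring
  · rw [min_eq_right h, abs_of_nonneg h]; ring

/-- Pointwise form of the diagonal-band integrand:
`min(-4t'ab, 0) = -2t'ab - 2|t'||a||b|`. [folklore] -/
private theorem min_diag_eq (t' a b : ℝ) :
    min (-t' * (4 * a * b)) 0 = -(2 * t') * (a * b) - 2 * |t'| * (|a| * |b|) := by
  rw [min_zero_eq_half]
  have habs : |-t' * (4 * a * b)| = 4 * |t'| * (|a| * |b|) := by
    simp only [abs_mul, abs_neg, abs_of_pos (by norm_num : (0 : ℝ) < 4)]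
    ring
  rw [habs]
  ring

/-- Inner integral: `∫_{-π}^{π} min(-4t' cos x cos y, 0) dy = -8|t'| |cos x|`. [folklore] -/
private theorem integral_inner_diag (t' x : ℝ) :
    ∫ y in (-π)..π, min (-t' * (4 * Real.cos x * Real.cos y)) 0 = -(8 * |t'|) * |Real.cos x| := by
  simp_rw [min_diag_eq]
  have hf : IntervalIntegrable (fun y => -(2 * t') * (Real.cos x * Real.cos y)) volume (-π) π :=
    (continuous_const.mul (continuous_const.mul Real.continuous_cos)).intervalIntegrable _ _
  have hg : IntervalIntegrable (fun y => 2 * |t'| * (|Real.cos x| * |Real.cos y|)) volume (-π) π :=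
    (continuous_const.mul (continuous_const.mul (continuous_abs.comp Real.continuous_cos))).intervalIntegrable _ _
  rw [intervalIntegral.integral_sub hf hg, intervalIntegral.integral_const_mul,
    intervalIntegral.integral_const_mul, intervalIntegral.integral_const_mul,
    intervalIntegral.integral_const_mul, integral_cos, integral_abs_cos, Real.sin_neg, Real.sin_pi]
  ring

/-- Outer integral: `∫_{-π}^{π} (-8|t'| |cos x|) dx = -32|t'|`. [folklore] -/
private theorem integral_outer_diag (t' : ℝ) :
    ∫ x in (-π)..π, -(8 * |t'|) * |Real.cos x| = -(32 * |t'|) := by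
  rw [intervalIntegral.integral_const_mul, integral_abs_cos]
  ring

/-- The Brillouin zone of `ℤ²` is the preimage of the square under `p ↦ (p 0, p 1)` (copy of the
private helper of `HubbardSquareFreeFermionEnergyDensity` §4). [folklore] -/
private theorem brillouin_two_eq_preimage_square' :
    brillouin 2 = (MeasurableEquiv.finTwoArrow : (Fin 2 → ℝ) ≃ᵐ ℝ × ℝ) ⁻¹'
      (Icc (-π) π ×ˢ Icc (-π) π) := by
  ext p
  simp only [brillouin, Set.mem_pi, Set.mem_univ, true_implies, Set.mem_preimage, Set.mem_prod]
  exact ⟨fun h => ⟨h 0, h 1⟩, fun h i => by fin_cases i <;> [exact h.1; exact h.2]⟩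

/-- A Brillouin-zone integral over `[-π,π]²` as an integral over the square in `ℝ × ℝ` (copy of the
private helper of `HubbardSquareFreeFermionEnergyDensity` §4). [folklore] -/
private theorem integral_brillouin_two_eq_integral_square' (g : ℝ × ℝ → ℝ) :
    ∫ p in brillouin 2, g (p 0, p 1) = ∫ q in Icc (-π) π ×ˢ Icc (-π) π, g q := by
  have h := (volume_preserving_finTwoArrow ℝ).setIntegral_preimage_emb
    (MeasurableEquiv.finTwoArrow : (Fin 2 → ℝ) ≃ᵐ ℝ × ℝ).measurableEmbedding g
    (Icc (-π) π ×ˢ Icc (-π) π)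
  rw [← brillouin_two_eq_preimage_square'] at h
  exact h

/-- Fubini on the square for a continuous integrand, with interval integrals (copy of the private
helper of `HubbardSquareFreeFermionEnergyDensity` §4). [folklore] -/
private theorem integral_square_eq_iterated' {g : ℝ × ℝ → ℝ} (hg : Continuous g) :
    ∫ q in Icc (-π) π ×ˢ Icc (-π) π, g q = ∫ x in (-π)..π, ∫ y in (-π)..π, g (x, y) := by
  have hππ : -π ≤ π := by linarith [Real.pi_pos]
  rw [Measure.volume_eq_prod, setIntegral_prod g
      (hg.continuousOn.integrableOn_compact (isCompact_Icc.prod isCompact_Icc)),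
    intervalIntegral.integral_of_le hππ, ← integral_Icc_eq_integral_Ioc]
  refine setIntegral_congr_fun measurableSet_Icc fun x _ => ?_
  rw [intervalIntegral.integral_of_le hππ, ← integral_Icc_eq_integral_Ioc]

/-- **`∫_{[-π,π]²} min(-4t' cos p₁ cos p₂, 0) dp = -32|t'|`** — the filled Fermi sea of the diagonal
band at chemical potential `0` has the same value as that of the nearest-neighbour band. [folklore] -/
private theorem integral_brillouin_two_min_diagBand (t' : ℝ) :
    ∫ p in brillouin 2, min (-t' * (4 * Real.cos (p 0) * Real.cos (p 1))) 0 = -(32 * |t'|) := by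
  have h := integral_brillouin_two_eq_integral_square'
    (fun q : ℝ × ℝ => min (-t' * (4 * Real.cos q.1 * Real.cos q.2)) 0)
  dsimp only at h
  rw [h, integral_square_eq_iterated' (by fun_prop)]
  dsimp only
  simp_rw [integral_inner_diag]
  exact integral_outer_diag t'

end DiagQuadrature

/-- `cos(2πk/L) = -cos(c_k)` componentwise (`2πk/L = c_k + π`, `c_k` the grid-cell corner). [folklore] -/
private theorem cos_latticeMomentum_eq_neg_cos_cellCorner {d L : ℕ} (k : TorusSite d L) (i : Fin d) :
    Real.cos (latticeMomentum L k i) = -Real.cos (cellCorner k i) := by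
  have h : latticeMomentum L k i = cellCorner k i + Real.pi := by
    simp only [latticeMomentum, cellCorner, gridStep]
    ring
  rw [h, Real.cos_add_pi]

/-- **Free Fermi-sea (bathtub) lower bound for the `t–t'` energy density, thermodynamic limit.** For
`U ≥ 0`, `0 ≤ n < 2`, all `t, t'` and every chemical potential `μ`:

  `μ n + 2 (2π)⁻² ∫_{[-π,π]²} min(ε(p) - μ, 0) dp ≤ e(t, t', U, n)`,
  `ε(p) = 2t(cos p₁ + cos p₂) - 4t' cos p₁ cos p₂`

(the `t–t'` band written at the grid-cell corners `c_k = 2πk/L - (π,π)`, i.e. `ε(p) = ε_phys(p + (π,π))`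
with `ε_phys(q) = -2t(cos q₁ + cos q₂) - 4t' cos q₁ cos q₂` — the same Fermi sea). The repulsion is
nonnegative and on every torus `L ≥ 3` the free Fermi sea is the kinetic minimum
(`TTPrimeFree.le_groundEnergy_hubbardTorusTT'`); the corner Riemann sums converge
(`tendsto_cornerRiemannSum`). The `t' = 0` case is the tree's `FreeKinetic.energyDensity2D_ge`.
[cite: LiebLoss1993, §8, Theorem 8.2] -/
theorem energyDensityTT'_ge_bathtub (t t' : ℝ) {U : ℝ} (hU : 0 ≤ U) {n : ℝ} (hn0 : 0 ≤ n)
    (hn2 : n < 2) (μ : ℝ) :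
    μ * n + 2 * (((2 * Real.pi) ^ 2)⁻¹ * ∫ p in brillouin 2,
      min (2 * t * (Real.cos (p 0) + Real.cos (p 1)) - 4 * t' * (Real.cos (p 0) * Real.cos (p 1)) - μ) 0) ≤
      energyDensityTT' t t' U n := by
  -- tori `L = m + 3`
  set φ : ℕ → ℕ := fun m => m + 3 with hφdef
  have hφ : Tendsto φ atTop atTop :=
    tendsto_atTop_atTop.2 fun b => ⟨b, fun m hm => by simp only [hφdef]; omega⟩
  have hlim : Tendsto (fun m => groundEnergy (hubbardTorusTT' (φ m) t t' U) (rectN n (φ m)) /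
      ((φ m : ℕ) : ℝ) ^ 2) atTop (𝓝 (energyDensityTT' t t' U n)) :=
    (tendsto_energyDensityTT'_torus t t' hU hn0 hn2).comp hφ
  set G : (Fin 2 → ℝ) → ℝ := fun p =>
    min (2 * t * (Real.cos (p 0) + Real.cos (p 1)) - 4 * t' * (Real.cos (p 0) * Real.cos (p 1)) - μ) 0
    with hGdef
  have hGc : Continuous G := by
    simp only [hGdef]
    fun_prop
  have hRS : Tendsto (fun m => ((2 * Real.pi) ^ 2)⁻¹ * cornerRiemannSum G (φ m))
      atTop (𝓝 (((2 * Real.pi) ^ 2)⁻¹ * ∫ p in brillouin 2, G p)) :=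
    ((tendsto_cornerRiemannSum hGc.continuousOn).comp hφ).const_mul _
  have hN : Tendsto (fun m => μ * ((rectN n (φ m) : ℝ) / ((φ m : ℕ) : ℝ) ^ 2)) atTop
      (𝓝 (μ * n)) :=
    ((tendsto_rectN_div_sq hn0).comp hφ).const_mul _
  have hb : Tendsto (fun m => μ * ((rectN n (φ m) : ℝ) / ((φ m : ℕ) : ℝ) ^ 2) +
      2 * (((2 * Real.pi) ^ 2)⁻¹ * cornerRiemannSum G (φ m))) atTop
      (𝓝 (μ * n + 2 * (((2 * Real.pi) ^ 2)⁻¹ * ∫ p in brillouin 2, G p))) :=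
    hN.add (hRS.const_mul 2)
  refine le_of_tendsto_of_tendsto hb hlim (Eventually.of_forall fun m => ?_)
  -- the torus bathtub bound on the torus of side `L = m + 3`, divided by `L²`
  dsimp only
  have hL3 : 3 ≤ φ m := by simp only [hφdef]; omega
  haveI : NeZero (φ m) := ⟨by omega⟩
  have hL2 : (0 : ℝ) < ((φ m : ℕ) : ℝ) ^ 2 := by
    have hLpos : (0 : ℝ) < ((φ m : ℕ) : ℝ) := by exact_mod_cast (show 0 < φ m by omega)
    positivity
  have hNle : rectN n (φ m) ≤ 2 * φ m ^ 2 := by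
    have := rectN_le_two_mul hn0 hn2.le (φ m)
    rwa [sq]
  have h := TTPrimeFree.le_groundEnergy_hubbardTorusTT' hL3 t t' hU μ hNle
  have hsum : ∑ k : TorusSite 2 (φ m), min (TTPrimeFree.ttBand (φ m) t t' k - μ) 0 =
      ∑ z : TorusSite 2 (φ m), G (cellCorner z) := by
    refine Finset.sum_congr rfl fun k _ => ?_
    rw [hGdef]
    dsimp only
    rw [TTPrimeFree.ttBand, Fin.sum_univ_two, cos_latticeMomentum_eq_neg_cos_cellCorner k 0,
      cos_latticeMomentum_eq_neg_cos_cellCorner k 1]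
    congr 1
    ring
  rw [hsum] at h
  rw [← HartreeFock.sum_cellCorner_div_eq, le_div_iff₀ hL2]
  have key : (μ * ((rectN n (φ m) : ℝ) / ((φ m : ℕ) : ℝ) ^ 2) +
      2 * ((∑ z : TorusSite 2 (φ m), G (cellCorner z)) / ((φ m : ℕ) : ℝ) ^ 2)) *
        ((φ m : ℕ) : ℝ) ^ 2 =
      μ * (rectN n (φ m) : ℝ) + 2 * ∑ z : TorusSite 2 (φ m), G (cellCorner z) := by
    field_simp
  rw [key]
  exact h

/-- **`-16|t'|/π² ≤ e(0, t', U, n)`** for `U ≥ 0`, `0 ≤ n < 2`: the pure next-nearest-neighbour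
(diagonal) hopping costs at most `16|t'|/π²` per site — the bathtub bound at `μ = 0` for the band
`-4t' cos p₁ cos p₂`, whose Fermi-sea integral is `∫ min(-4t' cos p₁ cos p₂, 0) = -32|t'|`, the same
value as for the nearest-neighbour band. [cite: LiebLoss1993, §8, Theorem 8.2] -/
theorem neg_sixteen_mul_abs_div_pi_sq_le_energyDensityTT'_diag (t' : ℝ) {U : ℝ} (hU : 0 ≤ U) {n : ℝ}
    (hn0 : 0 ≤ n) (hn2 : n < 2) : -(16 * |t'|) / Real.pi ^ 2 ≤ energyDensityTT' 0 t' U n := by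
  have h := energyDensityTT'_ge_bathtub 0 t' hU hn0 hn2 0
  have hint : (∫ p in brillouin 2, min (2 * (0 : ℝ) * (Real.cos (p 0) + Real.cos (p 1)) -
      4 * t' * (Real.cos (p 0) * Real.cos (p 1)) - 0) 0) =
      ∫ p in brillouin 2, min (-t' * (4 * Real.cos (p 0) * Real.cos (p 1))) 0 := by
    refine MeasureTheory.integral_congr_ae (Filter.Eventually.of_forall fun p => ?_)
    ring_nf
  rw [zero_mul, zero_add, hint, integral_brillouin_two_min_diagBand] at h
  have hval : 2 * (((2 * Real.pi) ^ 2)⁻¹ * -(32 * |t'|)) = -(16 * |t'|) / Real.pi ^ 2 := by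
    have hπ : Real.pi ≠ 0 := Real.pi_ne_zero
    field_simp
    ring
  rwa [hval] at h

namespace InfVolFermionState

/-- **Lower K₂ row** (`HOP2 ≤ 16/π²` in the engine's sign): for `ω` the torus limit along `Ls → ∞` of
unit `rectN n (Ls j)`-particle vectors (`0 ≤ n < 2`), `-16/π² ≤ K₂(ω) = e_{Φ(0,1,0)}(ω)` — the
variational inequality at the coupling `(0, 1, 0)` and the diagonal-band floor.
[cite: LiebLoss1993, §8, Theorem 8.2] [cite: Ruelle1969, §3.4] -/
theorem IsTorusLimitOf.neg_sixteen_div_pi_sq_le_meanEnergy_diagHop {n : ℝ} (hn0 : 0 ≤ n) (hn2 : n < 2)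
    {ω : InfVolFermionState 2} {ψ : ∀ L, Fock (Orb (FermionTorus 2 L))} {Ls : ℕ → ℕ}
    (h : ω.IsTorusLimitOf ψ Ls) (hLs : Tendsto Ls atTop atTop)
    (hN : ∀ j, IsNParticle (rectN n (Ls j)) (ψ (Ls j)))
    (h1 : ∀ j, star (ψ (Ls j)) ⬝ᵥ ψ (Ls j) = 1) :
    -16 / Real.pi ^ 2 ≤ ω.meanEnergy (hubbardTTPrimeFermionInteraction 0 1 0) 1 := by
  have hvar := h.energyDensityTT'_le_meanEnergy_hubbardTTPrime 0 1 le_rfl hn0 hn2 hLs hN h1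
  have hfloor := neg_sixteen_mul_abs_div_pi_sq_le_energyDensityTT'_diag 1 le_rfl hn0 hn2
  rw [abs_one, mul_one] at hfloor
  exact hfloor.trans hvar

/-- **Upper K₂ row** (`-HOP2 ≤ 16/π²`): same states, `K₂(ω) ≤ 16/π²` (the coupling `(0, -1, 0)`).
[cite: LiebLoss1993, §8, Theorem 8.2] [cite: Ruelle1969, §3.4] -/
theorem IsTorusLimitOf.meanEnergy_diagHop_le_sixteen_div_pi_sq {n : ℝ} (hn0 : 0 ≤ n) (hn2 : n < 2)
    {ω : InfVolFermionState 2} {ψ : ∀ L, Fock (Orb (FermionTorus 2 L))} {Ls : ℕ → ℕ}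
    (h : ω.IsTorusLimitOf ψ Ls) (hLs : Tendsto Ls atTop atTop)
    (hN : ∀ j, IsNParticle (rectN n (Ls j)) (ψ (Ls j)))
    (h1 : ∀ j, star (ψ (Ls j)) ⬝ᵥ ψ (Ls j) = 1) :
    ω.meanEnergy (hubbardTTPrimeFermionInteraction 0 1 0) 1 ≤ 16 / Real.pi ^ 2 := by
  have hvar := h.energyDensityTT'_le_meanEnergy_hubbardTTPrime 0 (-1) le_rfl hn0 hn2 hLs hN h1
  have hfloor := neg_sixteen_mul_abs_div_pi_sq_le_energyDensityTT'_diag (-1) le_rfl hn0 hn2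
  rw [abs_neg, abs_one, mul_one] at hfloor
  have hsm : ω.meanEnergy (hubbardTTPrimeFermionInteraction 0 (-1) 0) 1 =
      -1 * ω.meanEnergy (hubbardTTPrimeFermionInteraction 0 1 0) 1 := by
    have hs := ω.meanEnergy_hubbardTTPrime_smul (-1) 0 1 0
    rwa [mul_one, mul_zero] at hs
  rw [hsm] at hvar
  have := hfloor.trans hvar
  rw [neg_div] at this
  linarith

/-- **`|K₂(ω)| ≤ 16/π²`**: the diagonal hopping energy per site of every torus limit of unit
fixed-density vectors lies in the range of the diagonal band filled to half filling (same value as the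
nearest-neighbour band). [cite: LiebLoss1993, §8, Theorem 8.2] -/
theorem IsTorusLimitOf.abs_meanEnergy_diagHop_le {n : ℝ} (hn0 : 0 ≤ n) (hn2 : n < 2)
    {ω : InfVolFermionState 2} {ψ : ∀ L, Fock (Orb (FermionTorus 2 L))} {Ls : ℕ → ℕ}
    (h : ω.IsTorusLimitOf ψ Ls) (hLs : Tendsto Ls atTop atTop)
    (hN : ∀ j, IsNParticle (rectN n (Ls j)) (ψ (Ls j)))
    (h1 : ∀ j, star (ψ (Ls j)) ⬝ᵥ ψ (Ls j) = 1) :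
    |ω.meanEnergy (hubbardTTPrimeFermionInteraction 0 1 0) 1| ≤ 16 / Real.pi ^ 2 :=
  abs_le.2 ⟨by simpa only [neg_div] using h.neg_sixteen_div_pi_sq_le_meanEnergy_diagHop hn0 hn2 hLs hN h1,
    h.meanEnergy_diagHop_le_sixteen_div_pi_sq hn0 hn2 hLs hN h1⟩

/-- General amplitude: `|e_{Φ(0,t',0)}(ω)| ≤ 16|t'|/π²` (`e_{Φ(0,t',0)} = t'·K₂`).
[cite: LiebLoss1993, §8, Theorem 8.2] -/
theorem IsTorusLimitOf.abs_meanEnergy_diagHop_smul_le (t' : ℝ) {n : ℝ} (hn0 : 0 ≤ n) (hn2 : n < 2)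
    {ω : InfVolFermionState 2} {ψ : ∀ L, Fock (Orb (FermionTorus 2 L))} {Ls : ℕ → ℕ}
    (h : ω.IsTorusLimitOf ψ Ls) (hLs : Tendsto Ls atTop atTop)
    (hN : ∀ j, IsNParticle (rectN n (Ls j)) (ψ (Ls j)))
    (h1 : ∀ j, star (ψ (Ls j)) ⬝ᵥ ψ (Ls j) = 1) :
    |ω.meanEnergy (hubbardTTPrimeFermionInteraction 0 t' 0) 1| ≤ 16 * |t'| / Real.pi ^ 2 := by
  have hsm : ω.meanEnergy (hubbardTTPrimeFermionInteraction 0 t' 0) 1 =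
      t' * ω.meanEnergy (hubbardTTPrimeFermionInteraction 0 1 0) 1 := by
    have hs := ω.meanEnergy_hubbardTTPrime_smul t' 0 1 0
    rwa [mul_one, mul_zero] at hs
  rw [hsm, abs_mul, mul_comm (16 : ℝ) |t'|, mul_div_assoc]
  exact mul_le_mul_of_nonneg_left (h.abs_meanEnergy_diagHop_le hn0 hn2 hLs hN h1) (abs_nonneg t')

/-- **The engine's K₂ rows with their outward decimal**: `|K₂(ω)| ≤ 1.6211390` (both rows
`±HOP2 ≤ 16211390/10⁷`). [cite: LiebLoss1993, §8, Theorem 8.2] -/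
theorem IsTorusLimitOf.abs_meanEnergy_diagHop_le_decimal {n : ℝ} (hn0 : 0 ≤ n) (hn2 : n < 2)
    {ω : InfVolFermionState 2} {ψ : ∀ L, Fock (Orb (FermionTorus 2 L))} {Ls : ℕ → ℕ}
    (h : ω.IsTorusLimitOf ψ Ls) (hLs : Tendsto Ls atTop atTop)
    (hN : ∀ j, IsNParticle (rectN n (Ls j)) (ψ (Ls j)))
    (h1 : ∀ j, star (ψ (Ls j)) ⬝ᵥ ψ (Ls j) = 1) :
    |ω.meanEnergy (hubbardTTPrimeFermionInteraction 0 1 0) 1| ≤ (1.6211390 : ℝ) :=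
  (h.abs_meanEnergy_diagHop_le hn0 hn2 hLs hN h1).trans sixteen_div_pi_sq_lt_decimal.le

/-! ### §4 D rows: the double-occupancy density -/

/-- **`0 ≤ Re ω(n_{0↑} n_{0↓})`** for every infinite-volume state (`n_↑ n_↓` is a projection).
[cite: BratteliRobinsonI1987, §2.3.2] -/
theorem re_expect_docc_nonneg (ω : InfVolFermionState 2) :
    0 ≤ (ω.expect {0} (nAt (0 : Site 2) (mem_singleton_self 0) 0 * nAt 0 (mem_singleton_self 0) 1)).re := by
  have hc : Commute (nAt (0 : Site 2) (mem_singleton_self (0 : Site 2)) 0 : FermionOp {0})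
      (nAt 0 (mem_singleton_self 0) 1) := by
    rw [nAt, nAt, ← numberAt_orb, ← numberAt_orb]
    exact numberAt_commute _ _
  have hP := isHermitian_isIdempotentElem_mul_of_commute hc
    (by rw [nAt, ← numberAt_orb]; exact numberAt_isHermitian _)
    (by rw [nAt, ← numberAt_orb]; exact numberAt_idempotent _)
    (by rw [nAt, ← numberAt_orb]; exact numberAt_isHermitian _)
    (by rw [nAt, ← numberAt_orb]; exact numberAt_idempotent _)
  exact ω.re_expect_nonneg_of_isHermitian_of_isIdempotentElem {0} hP.1 hP.2

/-- **`Re ω(n_{0↑} n_{0↓}) ≤ Re ω(n_{0↓})`** for every state (`(1 - n_↑) n_↓` is a projection; the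
tree's `re_expect_nAt_mul_nAt_le` is the spin-up version). [cite: BratteliRobinsonI1987, §2.3.2] -/
theorem re_expect_nAt_mul_nAt_le_down (ω : InfVolFermionState 2) :
    (ω.expect {0} (nAt (0 : Site 2) (mem_singleton_self 0) 0 * nAt 0 (mem_singleton_self 0) 1)).re ≤
      (ω.expect {0} (nAt (0 : Site 2) (mem_singleton_self 0) 1)).re := by
  have hc : Commute (1 - nAt (0 : Site 2) (mem_singleton_self (0 : Site 2)) 0 : FermionOp {0})
      (nAt 0 (mem_singleton_self 0) 1) :=
    (Commute.one_left _).sub_left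
      (by rw [nAt, nAt, ← numberAt_orb, ← numberAt_orb]; exact numberAt_commute _ _)
  have hP := isHermitian_isIdempotentElem_mul_of_commute hc
    (Matrix.isHermitian_one.sub (by rw [nAt, ← numberAt_orb]; exact numberAt_isHermitian _))
    (by rw [nAt, ← numberAt_orb]; exact (numberAt_idempotent _).one_sub)
    (by rw [nAt, ← numberAt_orb]; exact numberAt_isHermitian _)
    (by rw [nAt, ← numberAt_orb]; exact numberAt_idempotent _)
  have h := ω.re_expect_nonneg_of_isHermitian_of_isIdempotentElem {0} hP.1 hP.2
  rw [sub_mul, one_mul, map_sub, Complex.sub_re] at h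
  linarith

/-- **Lower D row, `D(ω) ≥ 0`**: the double-occupancy density `D(ω) = e_{Φ(0,0,1)}(ω)` of a torus limit
is nonnegative. [cite: KomaTasaki1994, §1] -/
theorem IsTorusLimitOf.docc_nonneg {ω : InfVolFermionState 2} {ψ : ∀ L, Fock (Orb (FermionTorus 2 L))}
    {Ls : ℕ → ℕ} (h : ω.IsTorusLimitOf ψ Ls) (hLs : Tendsto Ls atTop atTop) :
    0 ≤ ω.meanEnergy (hubbardTTPrimeFermionInteraction 0 0 1) 1 := by
  rw [h.meanEnergy_onSite_eq_re_expect_docc hLs]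
  exact ω.re_expect_docc_nonneg

/-- **Upper D row, `D(ω) ≤ n/2`**: for `ω` the torus limit along `Ls → ∞` of unit
`rectN n (Ls j)`-particle vectors (`0 ≤ n`; no `S^z` hypothesis), `D(ω) ≤ n/2`
(`D ≤ Re ω(n_{0↑})`, `D ≤ Re ω(n_{0↓})`, `Re ω(n_{0↑}) + Re ω(n_{0↓}) = n`). [cite: Ruelle1969, §3.4] -/
theorem IsTorusLimitOf.docc_le_half_density {n : ℝ} (hn0 : 0 ≤ n)
    {ω : InfVolFermionState 2} {ψ : ∀ L, Fock (Orb (FermionTorus 2 L))} {Ls : ℕ → ℕ}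
    (h : ω.IsTorusLimitOf ψ Ls) (hLs : Tendsto Ls atTop atTop)
    (hN : ∀ j, IsNParticle (rectN n (Ls j)) (ψ (Ls j)))
    (h1 : ∀ j, star (ψ (Ls j)) ⬝ᵥ ψ (Ls j) = 1) :
    ω.meanEnergy (hubbardTTPrimeFermionInteraction 0 0 1) 1 ≤ n / 2 := by
  rw [h.meanEnergy_onSite_eq_re_expect_docc hLs]
  have hρ := h.density_eq_of_rectN hLs hn0 hN h1
  rw [InfVolFermionState.density, InfVolFermionState.densityAt, map_add, Complex.add_re] at hρ
  have hu := ω.re_expect_nAt_mul_nAt_le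
  have hd := ω.re_expect_nAt_mul_nAt_le_down
  linarith

/-- **Density row, `n - 1 ≤ D(ω)`** (informative above half filling): same states,
`n - 1 ≤ D(ω)` (`(1 - n_↑)(1 - n_↓)` is a projection). [cite: Ruelle1969, §3.4] -/
theorem IsTorusLimitOf.density_sub_one_le_docc {n : ℝ} (hn0 : 0 ≤ n)
    {ω : InfVolFermionState 2} {ψ : ∀ L, Fock (Orb (FermionTorus 2 L))} {Ls : ℕ → ℕ}
    (h : ω.IsTorusLimitOf ψ Ls) (hLs : Tendsto Ls atTop atTop)
    (hN : ∀ j, IsNParticle (rectN n (Ls j)) (ψ (Ls j)))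
    (h1 : ∀ j, star (ψ (Ls j)) ⬝ᵥ ψ (Ls j) = 1) :
    n - 1 ≤ ω.meanEnergy (hubbardTTPrimeFermionInteraction 0 0 1) 1 := by
  rw [h.meanEnergy_onSite_eq_re_expect_docc hLs]
  have hρ := h.density_eq_of_rectN hLs hn0 hN h1
  rw [InfVolFermionState.density, InfVolFermionState.densityAt, map_add, Complex.add_re] at hρ
  have hl := ω.re_expect_nAt_add_sub_one_le
  linarith

end InfVolFermionState

/-! ### §5 The same rows for mixture (e.g. thermal) torus limits -/

namespace InfVolFermionState

/-- **The particle density of a mixture torus limit.** Let `ω` be the torus limit along `Ls → ∞` of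
finite mixtures with weights summing to one (no sign condition needed here), the components at side
`L` being `N L`-particle unit vectors with `N (Ls j) / (Ls j)^d → ρ`. Then `ω.density = ρ`: the
averaged local density of every component is exactly `N L / L^d` (`torusAvgExpect_nAt_add_nAt`), so the
weighted sum is `N L / L^d` at every side. Bratteli–Robinson II §6.2.2; Ruelle (1969) §3.4.
[cite: Ruelle1969, §3.4] -/
theorem IsTorusLimitOfMixture.density_eq {d : ℕ} {ω : InfVolFermionState d} {m : ℕ → ℕ}
    {p : ∀ L, Fin (m L) → ℝ} {ψ : ∀ L, Fin (m L) → Fock (Orb (FermionTorus d L))} {Ls : ℕ → ℕ}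
    (h : ω.IsTorusLimitOfMixture m p ψ Ls) (hLs : Tendsto Ls atTop atTop)
    (hp1 : ∀ L, ∑ i, p L i = 1) {N : ℕ → ℕ} (hN : ∀ L i, IsNParticle (N L) (ψ L i))
    (hψ : ∀ L i, star (ψ L i) ⬝ᵥ ψ L i = 1) {ρ : ℝ}
    (hρ : Tendsto (fun j => (N (Ls j) : ℝ) / (Ls j : ℝ) ^ d) atTop (𝓝 ρ)) : ω.density = ρ := by
  have hlim := h ({0} : Finset (Site d))
    (nAt 0 (Finset.mem_singleton_self 0) 0 + nAt 0 (Finset.mem_singleton_self 0) 1)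
  have hρ' : Tendsto (fun j => (((N (Ls j) : ℝ) / (Ls j : ℝ) ^ d : ℝ) : ℂ)) atTop (𝓝 (ρ : ℂ)) :=
    (Complex.continuous_ofReal.tendsto ρ).comp hρ
  have heq : ∀ᶠ j in atTop, ∑ i, (p (Ls j) i : ℂ) * torusAvgExpect (Ls j) ({0} : Finset (Site d))
      (nAt 0 (Finset.mem_singleton_self 0) 0 + nAt 0 (Finset.mem_singleton_self 0) 1) (ψ (Ls j) i) =
        (((N (Ls j) : ℝ) / (Ls j : ℝ) ^ d : ℝ) : ℂ) := by
    filter_upwards [hLs.eventually_ge_atTop 1] with j hj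
    haveI : NeZero (Ls j) := ⟨Nat.one_le_iff_ne_zero.1 hj⟩
    have hcomp : ∀ i, torusAvgExpect (Ls j) ({0} : Finset (Site d))
        (nAt 0 (Finset.mem_singleton_self 0) 0 + nAt 0 (Finset.mem_singleton_self 0) 1) (ψ (Ls j) i) =
          (N (Ls j) : ℂ) / ((Ls j : ℂ) ^ d) := fun i =>
      torusAvgExpect_nAt_add_nAt (Ls j) (hN _ i) (hψ _ i)
    simp_rw [hcomp]
    rw [← Finset.sum_mul, ← Complex.ofReal_sum, hp1]
    push_cast
    ring
  have hval : ω.expect {0}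
      (nAt 0 (Finset.mem_singleton_self 0) 0 + nAt 0 (Finset.mem_singleton_self 0) 1) = (ρ : ℂ) :=
    tendsto_nhds_unique hlim (hρ'.congr' (heq.mono fun j hj => hj.symm))
  rw [InfVolFermionState.density, InfVolFermionState.densityAt, hval, Complex.ofReal_re]

/-- **Mixture torus limits of the density-`n` families have density `n`** (two dimensions,
components in the sectors `rectN n L = 2⌊nL²/2⌋`, weights summing to one, `Ls → ∞`).
[cite: Ruelle1969, §3.4] -/
theorem IsTorusLimitOfMixture.density_eq_of_rectN {ω : InfVolFermionState 2} {m : ℕ → ℕ}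
    {p : ∀ L, Fin (m L) → ℝ} {ψ : ∀ L, Fin (m L) → Fock (Orb (FermionTorus 2 L))} {Ls : ℕ → ℕ}
    (h : ω.IsTorusLimitOfMixture m p ψ Ls) (hLs : Tendsto Ls atTop atTop)
    (hp1 : ∀ L, ∑ i, p L i = 1) {n : ℝ} (hn : 0 ≤ n)
    (hN : ∀ L i, IsNParticle (rectN n L) (ψ L i)) (hψ : ∀ L i, star (ψ L i) ⬝ᵥ ψ L i = 1) :
    ω.density = n :=
  h.density_eq hLs hp1 hN hψ ((tendsto_rectN_div_sq hn).comp hLs)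

/-- **Lower K₁ row for mixture torus limits** (`HOP1 ≤ 16/π²`): if `ω` is the torus limit along
`Ls → ∞` of finite mixtures (weights `p ≥ 0`, `Σ_i p_{L,i} = 1`) of unit `rectN n L`-particle vectors
(`0 ≤ n < 2`) — e.g. of canonical Gibbs states on these sectors at any temperature — then
`-16/π² ≤ K₁(ω)`: the mixture variational inequality at the coupling `(1, 0, 0)` and the half-filled
free floor. [cite: LiebLoss1993, §8, Theorem 8.2] [cite: Ruelle1969, §3.4] -/
theorem IsTorusLimitOfMixture.neg_sixteen_div_pi_sq_le_meanEnergy_nnHop {n : ℝ} (hn0 : 0 ≤ n)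
    (hn2 : n < 2) {ω : InfVolFermionState 2} {m : ℕ → ℕ} {p : ∀ L, Fin (m L) → ℝ}
    {ψ : ∀ L, Fin (m L) → Fock (Orb (FermionTorus 2 L))} {Ls : ℕ → ℕ}
    (h : ω.IsTorusLimitOfMixture m p ψ Ls) (hLs : Tendsto Ls atTop atTop)
    (hp0 : ∀ L i, 0 ≤ p L i) (hp1 : ∀ L, ∑ i, p L i = 1)
    (hN : ∀ L i, IsNParticle (rectN n L) (ψ L i)) (h1 : ∀ L i, star (ψ L i) ⬝ᵥ ψ L i = 1) :
    -16 / Real.pi ^ 2 ≤ ω.meanEnergy (hubbardTTPrimeFermionInteraction 1 0 0) 1 := by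
  have hvar := h.energyDensityTT'_le_meanEnergy_hubbardTTPrime 1 0 le_rfl hn0 hn2 hLs hp0 hp1 hN h1
  have hfloor := neg_sixteen_mul_abs_div_pi_sq_le_energyDensityTT' 1 le_rfl hn0 hn2
  rw [abs_one, mul_one] at hfloor
  exact hfloor.trans hvar

/-- **Upper K₁ row for mixture torus limits** (`-HOP1 ≤ 16/π²`): same states, `K₁(ω) ≤ 16/π²`
(the coupling `(-1, 0, 0)`). [cite: LiebLoss1993, §8, Theorem 8.2] [cite: Ruelle1969, §3.4] -/
theorem IsTorusLimitOfMixture.meanEnergy_nnHop_le_sixteen_div_pi_sq {n : ℝ} (hn0 : 0 ≤ n)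
    (hn2 : n < 2) {ω : InfVolFermionState 2} {m : ℕ → ℕ} {p : ∀ L, Fin (m L) → ℝ}
    {ψ : ∀ L, Fin (m L) → Fock (Orb (FermionTorus 2 L))} {Ls : ℕ → ℕ}
    (h : ω.IsTorusLimitOfMixture m p ψ Ls) (hLs : Tendsto Ls atTop atTop)
    (hp0 : ∀ L i, 0 ≤ p L i) (hp1 : ∀ L, ∑ i, p L i = 1)
    (hN : ∀ L i, IsNParticle (rectN n L) (ψ L i)) (h1 : ∀ L i, star (ψ L i) ⬝ᵥ ψ L i = 1) :
    ω.meanEnergy (hubbardTTPrimeFermionInteraction 1 0 0) 1 ≤ 16 / Real.pi ^ 2 := by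
  have hvar :=
    h.energyDensityTT'_le_meanEnergy_hubbardTTPrime (-1) 0 le_rfl hn0 hn2 hLs hp0 hp1 hN h1
  have hfloor := neg_sixteen_mul_abs_div_pi_sq_le_energyDensityTT' (-1) le_rfl hn0 hn2
  rw [abs_neg, abs_one, mul_one] at hfloor
  have hsm : ω.meanEnergy (hubbardTTPrimeFermionInteraction (-1) 0 0) 1 =
      -1 * ω.meanEnergy (hubbardTTPrimeFermionInteraction 1 0 0) 1 := by
    have hs := ω.meanEnergy_hubbardTTPrime_smul (-1) 1 0 0
    rwa [mul_one, mul_zero] at hs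
  rw [hsm] at hvar
  have := hfloor.trans hvar
  rw [neg_div] at this
  linarith

/-- **`|K₁(ω)| ≤ 16/π²` for mixture torus limits** of unit fixed-density vectors.
[cite: LiebLoss1993, §8, Theorem 8.2] -/
theorem IsTorusLimitOfMixture.abs_meanEnergy_nnHop_le {n : ℝ} (hn0 : 0 ≤ n) (hn2 : n < 2)
    {ω : InfVolFermionState 2} {m : ℕ → ℕ} {p : ∀ L, Fin (m L) → ℝ}
    {ψ : ∀ L, Fin (m L) → Fock (Orb (FermionTorus 2 L))} {Ls : ℕ → ℕ}
    (h : ω.IsTorusLimitOfMixture m p ψ Ls) (hLs : Tendsto Ls atTop atTop)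
    (hp0 : ∀ L i, 0 ≤ p L i) (hp1 : ∀ L, ∑ i, p L i = 1)
    (hN : ∀ L i, IsNParticle (rectN n L) (ψ L i)) (h1 : ∀ L i, star (ψ L i) ⬝ᵥ ψ L i = 1) :
    |ω.meanEnergy (hubbardTTPrimeFermionInteraction 1 0 0) 1| ≤ 16 / Real.pi ^ 2 :=
  abs_le.2 ⟨by simpa only [neg_div] using
      h.neg_sixteen_div_pi_sq_le_meanEnergy_nnHop hn0 hn2 hLs hp0 hp1 hN h1,
    h.meanEnergy_nnHop_le_sixteen_div_pi_sq hn0 hn2 hLs hp0 hp1 hN h1⟩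

/-- General amplitude, mixture torus limits: `|e_{Φ(t,0,0)}(ω)| ≤ 16|t|/π²`.
[cite: LiebLoss1993, §8, Theorem 8.2] -/
theorem IsTorusLimitOfMixture.abs_meanEnergy_hop_le (t : ℝ) {n : ℝ} (hn0 : 0 ≤ n) (hn2 : n < 2)
    {ω : InfVolFermionState 2} {m : ℕ → ℕ} {p : ∀ L, Fin (m L) → ℝ}
    {ψ : ∀ L, Fin (m L) → Fock (Orb (FermionTorus 2 L))} {Ls : ℕ → ℕ}
    (h : ω.IsTorusLimitOfMixture m p ψ Ls) (hLs : Tendsto Ls atTop atTop)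
    (hp0 : ∀ L i, 0 ≤ p L i) (hp1 : ∀ L, ∑ i, p L i = 1)
    (hN : ∀ L i, IsNParticle (rectN n L) (ψ L i)) (h1 : ∀ L i, star (ψ L i) ⬝ᵥ ψ L i = 1) :
    |ω.meanEnergy (hubbardTTPrimeFermionInteraction t 0 0) 1| ≤ 16 * |t| / Real.pi ^ 2 := by
  have hsm : ω.meanEnergy (hubbardTTPrimeFermionInteraction t 0 0) 1 =
      t * ω.meanEnergy (hubbardTTPrimeFermionInteraction 1 0 0) 1 := by
    have hs := ω.meanEnergy_hubbardTTPrime_smul t 1 0 0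
    rwa [mul_one, mul_zero] at hs
  rw [hsm, abs_mul, mul_comm (16 : ℝ) |t|, mul_div_assoc]
  exact mul_le_mul_of_nonneg_left (h.abs_meanEnergy_nnHop_le hn0 hn2 hLs hp0 hp1 hN h1)
    (abs_nonneg t)

/-- **The engine's K₁ rows with their outward decimal, mixture torus limits**:
`|K₁(ω)| ≤ 1.6211390`. [cite: LiebLoss1993, §8, Theorem 8.2] -/
theorem IsTorusLimitOfMixture.abs_meanEnergy_nnHop_le_decimal {n : ℝ} (hn0 : 0 ≤ n) (hn2 : n < 2)
    {ω : InfVolFermionState 2} {m : ℕ → ℕ} {p : ∀ L, Fin (m L) → ℝ}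
    {ψ : ∀ L, Fin (m L) → Fock (Orb (FermionTorus 2 L))} {Ls : ℕ → ℕ}
    (h : ω.IsTorusLimitOfMixture m p ψ Ls) (hLs : Tendsto Ls atTop atTop)
    (hp0 : ∀ L i, 0 ≤ p L i) (hp1 : ∀ L, ∑ i, p L i = 1)
    (hN : ∀ L i, IsNParticle (rectN n L) (ψ L i)) (h1 : ∀ L i, star (ψ L i) ⬝ᵥ ψ L i = 1) :
    |ω.meanEnergy (hubbardTTPrimeFermionInteraction 1 0 0) 1| ≤ (1.6211390 : ℝ) :=
  (h.abs_meanEnergy_nnHop_le hn0 hn2 hLs hp0 hp1 hN h1).trans sixteen_div_pi_sq_lt_decimal.le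

/-- **Lower K₂ row for mixture torus limits** (`HOP2 ≤ 16/π²`): `-16/π² ≤ K₂(ω)` (the coupling
`(0, 1, 0)` and the diagonal-band floor). [cite: LiebLoss1993, §8, Theorem 8.2] [cite: Ruelle1969, §3.4] -/
theorem IsTorusLimitOfMixture.neg_sixteen_div_pi_sq_le_meanEnergy_diagHop {n : ℝ} (hn0 : 0 ≤ n)
    (hn2 : n < 2) {ω : InfVolFermionState 2} {m : ℕ → ℕ} {p : ∀ L, Fin (m L) → ℝ}
    {ψ : ∀ L, Fin (m L) → Fock (Orb (FermionTorus 2 L))} {Ls : ℕ → ℕ}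
    (h : ω.IsTorusLimitOfMixture m p ψ Ls) (hLs : Tendsto Ls atTop atTop)
    (hp0 : ∀ L i, 0 ≤ p L i) (hp1 : ∀ L, ∑ i, p L i = 1)
    (hN : ∀ L i, IsNParticle (rectN n L) (ψ L i)) (h1 : ∀ L i, star (ψ L i) ⬝ᵥ ψ L i = 1) :
    -16 / Real.pi ^ 2 ≤ ω.meanEnergy (hubbardTTPrimeFermionInteraction 0 1 0) 1 := by
  have hvar := h.energyDensityTT'_le_meanEnergy_hubbardTTPrime 0 1 le_rfl hn0 hn2 hLs hp0 hp1 hN h1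
  have hfloor := neg_sixteen_mul_abs_div_pi_sq_le_energyDensityTT'_diag 1 le_rfl hn0 hn2
  rw [abs_one, mul_one] at hfloor
  exact hfloor.trans hvar

/-- **Upper K₂ row for mixture torus limits** (`-HOP2 ≤ 16/π²`): `K₂(ω) ≤ 16/π²` (the coupling
`(0, -1, 0)`). [cite: LiebLoss1993, §8, Theorem 8.2] [cite: Ruelle1969, §3.4] -/
theorem IsTorusLimitOfMixture.meanEnergy_diagHop_le_sixteen_div_pi_sq {n : ℝ} (hn0 : 0 ≤ n)
    (hn2 : n < 2) {ω : InfVolFermionState 2} {m : ℕ → ℕ} {p : ∀ L, Fin (m L) → ℝ}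
    {ψ : ∀ L, Fin (m L) → Fock (Orb (FermionTorus 2 L))} {Ls : ℕ → ℕ}
    (h : ω.IsTorusLimitOfMixture m p ψ Ls) (hLs : Tendsto Ls atTop atTop)
    (hp0 : ∀ L i, 0 ≤ p L i) (hp1 : ∀ L, ∑ i, p L i = 1)
    (hN : ∀ L i, IsNParticle (rectN n L) (ψ L i)) (h1 : ∀ L i, star (ψ L i) ⬝ᵥ ψ L i = 1) :
    ω.meanEnergy (hubbardTTPrimeFermionInteraction 0 1 0) 1 ≤ 16 / Real.pi ^ 2 := by
  have hvar :=
    h.energyDensityTT'_le_meanEnergy_hubbardTTPrime 0 (-1) le_rfl hn0 hn2 hLs hp0 hp1 hN h1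
  have hfloor := neg_sixteen_mul_abs_div_pi_sq_le_energyDensityTT'_diag (-1) le_rfl hn0 hn2
  rw [abs_neg, abs_one, mul_one] at hfloor
  have hsm : ω.meanEnergy (hubbardTTPrimeFermionInteraction 0 (-1) 0) 1 =
      -1 * ω.meanEnergy (hubbardTTPrimeFermionInteraction 0 1 0) 1 := by
    have hs := ω.meanEnergy_hubbardTTPrime_smul (-1) 0 1 0
    rwa [mul_one, mul_zero] at hs
  rw [hsm] at hvar
  have := hfloor.trans hvar
  rw [neg_div] at this
  linarith

/-- **`|K₂(ω)| ≤ 16/π²` for mixture torus limits** of unit fixed-density vectors.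
[cite: LiebLoss1993, §8, Theorem 8.2] -/
theorem IsTorusLimitOfMixture.abs_meanEnergy_diagHop_le {n : ℝ} (hn0 : 0 ≤ n) (hn2 : n < 2)
    {ω : InfVolFermionState 2} {m : ℕ → ℕ} {p : ∀ L, Fin (m L) → ℝ}
    {ψ : ∀ L, Fin (m L) → Fock (Orb (FermionTorus 2 L))} {Ls : ℕ → ℕ}
    (h : ω.IsTorusLimitOfMixture m p ψ Ls) (hLs : Tendsto Ls atTop atTop)
    (hp0 : ∀ L i, 0 ≤ p L i) (hp1 : ∀ L, ∑ i, p L i = 1)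
    (hN : ∀ L i, IsNParticle (rectN n L) (ψ L i)) (h1 : ∀ L i, star (ψ L i) ⬝ᵥ ψ L i = 1) :
    |ω.meanEnergy (hubbardTTPrimeFermionInteraction 0 1 0) 1| ≤ 16 / Real.pi ^ 2 :=
  abs_le.2 ⟨by simpa only [neg_div] using
      h.neg_sixteen_div_pi_sq_le_meanEnergy_diagHop hn0 hn2 hLs hp0 hp1 hN h1,
    h.meanEnergy_diagHop_le_sixteen_div_pi_sq hn0 hn2 hLs hp0 hp1 hN h1⟩

/-- General amplitude, mixture torus limits: `|e_{Φ(0,t',0)}(ω)| ≤ 16|t'|/π²`.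
[cite: LiebLoss1993, §8, Theorem 8.2] -/
theorem IsTorusLimitOfMixture.abs_meanEnergy_diagHop_smul_le (t' : ℝ) {n : ℝ} (hn0 : 0 ≤ n)
    (hn2 : n < 2) {ω : InfVolFermionState 2} {m : ℕ → ℕ} {p : ∀ L, Fin (m L) → ℝ}
    {ψ : ∀ L, Fin (m L) → Fock (Orb (FermionTorus 2 L))} {Ls : ℕ → ℕ}
    (h : ω.IsTorusLimitOfMixture m p ψ Ls) (hLs : Tendsto Ls atTop atTop)
    (hp0 : ∀ L i, 0 ≤ p L i) (hp1 : ∀ L, ∑ i, p L i = 1)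
    (hN : ∀ L i, IsNParticle (rectN n L) (ψ L i)) (h1 : ∀ L i, star (ψ L i) ⬝ᵥ ψ L i = 1) :
    |ω.meanEnergy (hubbardTTPrimeFermionInteraction 0 t' 0) 1| ≤ 16 * |t'| / Real.pi ^ 2 := by
  have hsm : ω.meanEnergy (hubbardTTPrimeFermionInteraction 0 t' 0) 1 =
      t' * ω.meanEnergy (hubbardTTPrimeFermionInteraction 0 1 0) 1 := by
    have hs := ω.meanEnergy_hubbardTTPrime_smul t' 0 1 0
    rwa [mul_one, mul_zero] at hs
  rw [hsm, abs_mul, mul_comm (16 : ℝ) |t'|, mul_div_assoc]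
  exact mul_le_mul_of_nonneg_left (h.abs_meanEnergy_diagHop_le hn0 hn2 hLs hp0 hp1 hN h1)
    (abs_nonneg t')

/-- **The engine's K₂ rows with their outward decimal, mixture torus limits**:
`|K₂(ω)| ≤ 1.6211390`. [cite: LiebLoss1993, §8, Theorem 8.2] -/
theorem IsTorusLimitOfMixture.abs_meanEnergy_diagHop_le_decimal {n : ℝ} (hn0 : 0 ≤ n)
    (hn2 : n < 2) {ω : InfVolFermionState 2} {m : ℕ → ℕ} {p : ∀ L, Fin (m L) → ℝ}
    {ψ : ∀ L, Fin (m L) → Fock (Orb (FermionTorus 2 L))} {Ls : ℕ → ℕ}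
    (h : ω.IsTorusLimitOfMixture m p ψ Ls) (hLs : Tendsto Ls atTop atTop)
    (hp0 : ∀ L i, 0 ≤ p L i) (hp1 : ∀ L, ∑ i, p L i = 1)
    (hN : ∀ L i, IsNParticle (rectN n L) (ψ L i)) (h1 : ∀ L i, star (ψ L i) ⬝ᵥ ψ L i = 1) :
    |ω.meanEnergy (hubbardTTPrimeFermionInteraction 0 1 0) 1| ≤ (1.6211390 : ℝ) :=
  (h.abs_meanEnergy_diagHop_le hn0 hn2 hLs hp0 hp1 hN h1).trans sixteen_div_pi_sq_lt_decimal.le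

/-- **Lower D row for mixture torus limits, `D(ω) ≥ 0`** (only the predicate and `Ls → ∞`).
[cite: KomaTasaki1994, §1] -/
theorem IsTorusLimitOfMixture.docc_nonneg {ω : InfVolFermionState 2} {m : ℕ → ℕ}
    {p : ∀ L, Fin (m L) → ℝ} {ψ : ∀ L, Fin (m L) → Fock (Orb (FermionTorus 2 L))} {Ls : ℕ → ℕ}
    (h : ω.IsTorusLimitOfMixture m p ψ Ls) (hLs : Tendsto Ls atTop atTop) :
    0 ≤ ω.meanEnergy (hubbardTTPrimeFermionInteraction 0 0 1) 1 := by
  rw [h.meanEnergy_onSite_eq_re_expect_docc hLs]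
  exact ω.re_expect_docc_nonneg

/-- **Upper D row for mixture torus limits, `D(ω) ≤ n/2`** (weights summing to one, unit
`rectN n L`-particle components, `0 ≤ n`; no `S^z` hypothesis). [cite: Ruelle1969, §3.4] -/
theorem IsTorusLimitOfMixture.docc_le_half_density {n : ℝ} (hn0 : 0 ≤ n)
    {ω : InfVolFermionState 2} {m : ℕ → ℕ} {p : ∀ L, Fin (m L) → ℝ}
    {ψ : ∀ L, Fin (m L) → Fock (Orb (FermionTorus 2 L))} {Ls : ℕ → ℕ}
    (h : ω.IsTorusLimitOfMixture m p ψ Ls) (hLs : Tendsto Ls atTop atTop)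
    (hp1 : ∀ L, ∑ i, p L i = 1)
    (hN : ∀ L i, IsNParticle (rectN n L) (ψ L i)) (h1 : ∀ L i, star (ψ L i) ⬝ᵥ ψ L i = 1) :
    ω.meanEnergy (hubbardTTPrimeFermionInteraction 0 0 1) 1 ≤ n / 2 := by
  rw [h.meanEnergy_onSite_eq_re_expect_docc hLs]
  have hρ := h.density_eq_of_rectN hLs hp1 hn0 hN h1
  rw [InfVolFermionState.density, InfVolFermionState.densityAt, map_add, Complex.add_re] at hρ
  have hu := ω.re_expect_nAt_mul_nAt_le
  have hd := ω.re_expect_nAt_mul_nAt_le_down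
  linarith

/-- **Density row for mixture torus limits, `n - 1 ≤ D(ω)`**. [cite: Ruelle1969, §3.4] -/
theorem IsTorusLimitOfMixture.density_sub_one_le_docc {n : ℝ} (hn0 : 0 ≤ n)
    {ω : InfVolFermionState 2} {m : ℕ → ℕ} {p : ∀ L, Fin (m L) → ℝ}
    {ψ : ∀ L, Fin (m L) → Fock (Orb (FermionTorus 2 L))} {Ls : ℕ → ℕ}
    (h : ω.IsTorusLimitOfMixture m p ψ Ls) (hLs : Tendsto Ls atTop atTop)
    (hp1 : ∀ L, ∑ i, p L i = 1)
    (hN : ∀ L i, IsNParticle (rectN n L) (ψ L i)) (h1 : ∀ L i, star (ψ L i) ⬝ᵥ ψ L i = 1) :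
    n - 1 ≤ ω.meanEnergy (hubbardTTPrimeFermionInteraction 0 0 1) 1 := by
  rw [h.meanEnergy_onSite_eq_re_expect_docc hLs]
  have hρ := h.density_eq_of_rectN hLs hp1 hn0 hN h1
  rw [InfVolFermionState.density, InfVolFermionState.densityAt, map_add, Complex.add_re] at hρ
  have hl := ω.re_expect_nAt_add_sub_one_le
  linarith

end InfVolFermionState

/-! ### §6 Fermi-sea corner-sum rows: a certified Riemann minorant of the bathtub bound

For `2|t'| ≤ t` the corner-written band `ε(p) = 2t(cos p₁ + cos p₂) - 4t' cos p₁ cos p₂` of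
`energyDensityTT'_ge_bathtub` is increasing in each cosine; equivalently
`E(a, b) := -2t(a + b) - 4t' a b` (`= ε` at `a = -cos p₁`, `b = -cos p₂`) is decreasing in each argument
on `[-1, 1]²`. Cut `[-π, π]²` into the `2M × 2M` cells of side `π/M`; on the cell
`[-π + l₁π/M, -π + (l₁+1)π/M] × [-π + l₂π/M, -π + (l₂+1)π/M]` one has `-cos p₁ ≤ cos(c(l₁)π/M)`,
`-cos p₂ ≤ cos(c(l₂)π/M)` with the folded cell index `c(l) = l` (`l < M`), `c(l) = 2M - 1 - l` (`l ≥ M`),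
so the integrand `min(ε(p) - μ, 0)` is at least `min(E(u_{c(l₁)}, u_{c(l₂)}) - μ, 0)` there for ANY numbers
`cos(iπ/M) ≤ uᵢ ≤ 1`. Summing the cells (each index `i < M` is hit by exactly two `l`) turns the bathtub
bound into the finite inequality

  `μ n + 2 M⁻² Σ_{i,j<M} min(E(uᵢ, uⱼ) - μ, 0) ≤ e(t, t', U, n)`   (`energyDensityTT'_ge_fermiSea_cornerSum`)

— planner-p2's `bathtub-corner/1` certificate of the hubbard-fast screening LP (2026-08-25), whose only
remaining input is a table of upper bounds `uᵢ` of `cos(iπ/M)`. With the cut-row machinery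
(`IsTorusLimitOf.energyDensityTT'_le_meanEnergy_hubbardTTPrime` at the coupling `(t, t', 0)`) a certified
`ℓ ≤ e(t, t', 0, n)` is the LP row `t·K₁(ω) + t'·K₂(ω) ≥ ℓ` for every torus limit `ω` of unit density-`n`
vectors. -/

section FermiSeaCornerSum

open Real Set MeasureTheory

/-- Monotonicity of the shifted band `E(a, b) = -2t(a + b) - 4t' a b` for `2|t'| ≤ t`: if `A ≤ a' ≤ 1`,
`B ≤ b'`, `-1 ≤ A` and `-1 ≤ B ≤ 1` then `min(E(a', b') - μ, 0) ≤ min(E(A, B) - μ, 0)`. [folklore] -/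
private theorem min_shiftedBand_le {t t' : ℝ} (htt' : 2 * |t'| ≤ t) (μ : ℝ) {A B a' b' : ℝ}
    (hA : A ≤ a') (hB : B ≤ b') (hA1 : -1 ≤ A) (ha'1 : a' ≤ 1) (hB1 : -1 ≤ B) (hB1' : B ≤ 1) :
    min (-(2 * t) * (a' + b') - 4 * t' * (a' * b') - μ) 0 ≤
      min (-(2 * t) * (A + B) - 4 * t' * (A * B) - μ) 0 := by
  apply min_le_min_right
  have h1 : 0 ≤ 2 * t + 4 * t' * B := by
    have h : -|t'| ≤ t' * B := by
      have h₁ := neg_abs_le (t' * B)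
      have h₂ : |t' * B| ≤ |t'| := by
        rw [abs_mul]
        exact mul_le_of_le_one_right (abs_nonneg _) (abs_le.2 ⟨hB1, hB1'⟩)
      linarith
    linarith
  have h2 : 0 ≤ 2 * t + 4 * t' * a' := by
    have h : -|t'| ≤ t' * a' := by
      have h₁ := neg_abs_le (t' * a')
      have h₂ : |t' * a'| ≤ |t'| := by
        rw [abs_mul]
        exact mul_le_of_le_one_right (abs_nonneg _) (abs_le.2 ⟨by linarith, ha'1⟩)
      linarith
    linarith
  nlinarith [mul_nonneg (sub_nonneg.2 hA) h1, mul_nonneg (sub_nonneg.2 hB) h2]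

/-- On the cell `-π + lπ/M ≤ x ≤ -π + (l+1)π/M` (`l < 2M`) the shifted cosine `-cos x` is at most
`cos(c π/M)` with the folded cell index `c = l` for `l < M` and `c = 2M - 1 - l` for `M ≤ l`
(`cos` is decreasing on `[0, π]`; `-cos x = cos(x + π) = cos(π - x)`). [folklore] -/
private theorem neg_cos_le_cos_foldedCell {M l : ℕ} (hM : 0 < M) (hl : l < 2 * M) {x : ℝ}
    (hx1 : -π + l * π / M ≤ x) (hx2 : x ≤ -π + (l + 1) * π / M) :
    -Real.cos x ≤ Real.cos (((if l < M then l else 2 * M - 1 - l : ℕ) : ℝ) * π / M) := by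
  have hMr : (0 : ℝ) < M := by exact_mod_cast hM
  have hπ := Real.pi_pos
  split_ifs with hlM
  · -- `x + π ∈ [lπ/M, (l+1)π/M] ⊆ [0, π]`
    rw [← Real.cos_add_pi]
    have hl1 : ((l : ℝ) + 1) * π / M ≤ π := by
      rw [div_le_iff₀ hMr]
      have h : (l : ℝ) + 1 ≤ M := by exact_mod_cast hlM
      nlinarith
    have hl0 : 0 ≤ (l : ℝ) * π / M := by positivity
    exact Real.cos_le_cos_of_nonneg_of_le_pi hl0 (by linarith) (by linarith)
  · -- `π - x ∈ [(2M-1-l)π/M, (2M-l)π/M] ⊆ [0, π]`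
    rw [not_lt] at hlM
    rw [← Real.cos_pi_sub]
    have hcast : ((2 * M - 1 - l : ℕ) : ℝ) = 2 * M - 1 - l := by
      rw [Nat.cast_sub (by omega), Nat.cast_sub (by omega)]
      push_cast
      ring
    rw [hcast]
    have hMl : π ≤ (l : ℝ) * π / M := by
      rw [le_div_iff₀ hMr]
      have h : (M : ℝ) ≤ l := by exact_mod_cast hlM
      nlinarith
    have h2Ml : 0 ≤ (2 * (M : ℝ) - 1 - l) * π / M := by
      have h : (l : ℝ) + 1 ≤ 2 * M := by exact_mod_cast (show l + 1 ≤ 2 * M by omega)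
      apply div_nonneg (mul_nonneg (by linarith) hπ.le) hMr.le
    have heq : (2 * (M : ℝ) - 1 - l) * π / M = 2 * π - ((l : ℝ) + 1) * π / M := by
      field_simp
      ring
    refine Real.cos_le_cos_of_nonneg_of_le_pi h2Ml (by linarith) ?_
    rw [heq]
    linarith

/-- **Riemann minorant on the uniform `2M × 2M` grid of `[-π, π]²`**: cell-wise constant lower bounds
`b l₁ l₂` of a continuous integrand `g` on the closed cells
`[-π + l₁π/M, -π + (l₁+1)π/M] × [-π + l₂π/M, -π + (l₂+1)π/M]` add up, with the cell area `(π/M)²`, to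
a lower bound of the iterated integral `∫_{-π}^{π} ∫_{-π}^{π} g`. [folklore] -/
private theorem gridSum_le_integral_square {g : ℝ → ℝ → ℝ} (hg : Continuous (Function.uncurry g))
    {M : ℕ} (hM : 0 < M) (b : ℕ → ℕ → ℝ)
    (hb : ∀ l₁, l₁ < 2 * M → ∀ l₂, l₂ < 2 * M →
      ∀ x ∈ Icc (-π + l₁ * π / M) (-π + (l₁ + 1) * π / M),
      ∀ y ∈ Icc (-π + l₂ * π / M) (-π + (l₂ + 1) * π / M), b l₁ l₂ ≤ g x y) :
    (π / M) ^ 2 * ∑ l₁ ∈ Finset.range (2 * M), ∑ l₂ ∈ Finset.range (2 * M), b l₁ l₂ ≤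
      ∫ x in (-π)..π, ∫ y in (-π)..π, g x y := by
  have hMr : (0 : ℝ) < M := by exact_mod_cast hM
  have hπ := Real.pi_pos
  -- the grid points `a l = -π + lπ/M`, `l = 0, …, 2M`
  set a : ℕ → ℝ := fun l => -π + l * π / M with ha
  have ha0 : a 0 = -π := by simp [ha]
  have ha2M : a (2 * M) = π := by
    simp only [ha]
    push_cast
    field_simp
    ring
  have hastep : ∀ l : ℕ, a (l + 1) - a l = π / M := by
    intro l
    simp only [ha]
    push_cast
    field_simp
    ring
  have hale : ∀ l : ℕ, a l ≤ a (l + 1) := fun l => by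
    have h := hastep l
    have h' : 0 ≤ π / M := by positivity
    linarith
  have haI : ∀ l : ℕ, Icc (a l) (a (l + 1)) = Icc (-π + l * π / M) (-π + (l + 1) * π / M) := by
    intro l
    simp only [ha, Nat.cast_add_one]
  have hgx : ∀ x, Continuous (g x) := fun x => hg.uncurry_left x
  have hF : Continuous fun x => ∫ y in (-π)..π, g x y :=
    intervalIntegral.continuous_parametric_intervalIntegral_of_continuous' hg (-π) π
  -- inner integrals on an outer cell
  have hinner : ∀ l₁, l₁ < 2 * M → ∀ x ∈ Icc (a l₁) (a (l₁ + 1)),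
      π / M * ∑ l₂ ∈ Finset.range (2 * M), b l₁ l₂ ≤ ∫ y in (-π)..π, g x y := by
    intro l₁ hl₁ x hx
    have hsplit : ∑ l₂ ∈ Finset.range (2 * M), ∫ y in (a l₂)..(a (l₂ + 1)), g x y =
        ∫ y in (-π)..π, g x y := by
      rw [intervalIntegral.sum_integral_adjacent_intervals fun k _ =>
        (hgx x).intervalIntegrable _ _, ha0, ha2M]
    rw [← hsplit, Finset.mul_sum]
    refine Finset.sum_le_sum fun l₂ hl₂ => ?_
    rw [Finset.mem_range] at hl₂
    calc π / M * b l₁ l₂ = ∫ _ in (a l₂)..(a (l₂ + 1)), b l₁ l₂ := by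
          rw [intervalIntegral.integral_const, smul_eq_mul, hastep]
      _ ≤ ∫ y in (a l₂)..(a (l₂ + 1)), g x y :=
          intervalIntegral.integral_mono_on (hale l₂) intervalIntegrable_const
            ((hgx x).intervalIntegrable _ _) fun y hy =>
              hb l₁ hl₁ l₂ hl₂ x (by rw [← haI]; exact hx) y (by rw [← haI]; exact hy)
  -- outer integral
  have hsplit : ∑ l₁ ∈ Finset.range (2 * M), ∫ x in (a l₁)..(a (l₁ + 1)), (∫ y in (-π)..π, g x y) =
      ∫ x in (-π)..π, ∫ y in (-π)..π, g x y := by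
    rw [intervalIntegral.sum_integral_adjacent_intervals fun k _ => hF.intervalIntegrable _ _, ha0, ha2M]
  rw [← hsplit, Finset.mul_sum]
  refine Finset.sum_le_sum fun l₁ hl₁ => ?_
  rw [Finset.mem_range] at hl₁
  calc (π / M) ^ 2 * ∑ l₂ ∈ Finset.range (2 * M), b l₁ l₂
        = ∫ _ in (a l₁)..(a (l₁ + 1)), π / M * ∑ l₂ ∈ Finset.range (2 * M), b l₁ l₂ := by
          rw [intervalIntegral.integral_const, smul_eq_mul, hastep]
          ring
    _ ≤ ∫ x in (a l₁)..(a (l₁ + 1)), ∫ y in (-π)..π, g x y :=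
          intervalIntegral.integral_mono_on (hale l₁) intervalIntegrable_const (hF.intervalIntegrable _ _)
            fun x hx => hinner l₁ hl₁ x hx

/-- Folding the `2M` cells of `[-π, π]` onto the `M` cells of `[0, π]`: every index `i < M` is the folded
cell index of exactly two cells. [folklore] -/
private theorem sum_range_two_mul_foldedCell {β : Type*} [AddCommMonoid β] (M : ℕ) (f : ℕ → β) :
    ∑ l ∈ Finset.range (2 * M), f (if l < M then l else 2 * M - 1 - l) =
      ∑ i ∈ Finset.range M, f i + ∑ i ∈ Finset.range M, f i := by
  rw [two_mul, Finset.sum_range_add]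
  congr 1
  · exact Finset.sum_congr rfl fun l hl => by
      rw [Finset.mem_range] at hl
      rw [if_pos hl]
  · rw [← Finset.sum_range_reflect f M]
    exact Finset.sum_congr rfl fun l hl => by
      rw [Finset.mem_range] at hl
      rw [if_neg (by omega)]
      congr 1
      omega

/-- **Fermi-sea corner-sum bound** (certified Riemann minorant of `energyDensityTT'_ge_bathtub`). Let
`2|t'| ≤ t`, `U ≥ 0`, `0 ≤ n < 2`, `M ≥ 1`, and let `u₀, …, u_{M-1}` be numbers with
`cos(iπ/M) ≤ uᵢ ≤ 1`. Then for every chemical potential `μ`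

  `μ n + 2 M⁻² Σ_{i,j<M} min(-2t(uᵢ + uⱼ) - 4t' uᵢ uⱼ - μ, 0) ≤ e(t, t', U, n)`.

Proof: the band of `energyDensityTT'_ge_bathtub` is `E(-cos p₁, -cos p₂)`,
`E(a, b) = -2t(a+b) - 4t'ab` decreasing in each argument on `[-1,1]²` (`2|t'| ≤ t`); on the `2M × 2M`
grid of `[-π,π]²` the integrand is bounded below cell-wise by `min(E(u_{c(l₁)}, u_{c(l₂)}) - μ, 0)`
(`neg_cos_le_cos_foldedCell`), the cells have area `(π/M)²`, each `i < M` is hit by two `l`, and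
`2 (2π)⁻² · 4 (π/M)² = 2/M²`. This is the statement verified by planner-p2's exact-rational
`bathtub-corner/1` certificates (hubbard-fast, 2026-08-25); the remaining input, a table of upper bounds
`uᵢ ≥ cos(iπ/M)`, is the user's. [cite: LiebLoss1993, §8, Theorem 8.2] -/
theorem energyDensityTT'_ge_fermiSea_cornerSum (t t' : ℝ) (htt' : 2 * |t'| ≤ t) {U : ℝ} (hU : 0 ≤ U)
    {n : ℝ} (hn0 : 0 ≤ n) (hn2 : n < 2) {M : ℕ} (hM : 0 < M) (u : ℕ → ℝ)
    (hu : ∀ i < M, Real.cos (i * π / M) ≤ u i) (hu1 : ∀ i < M, u i ≤ 1) (μ : ℝ) :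
    μ * n + 2 / (M : ℝ) ^ 2 * ∑ i ∈ Finset.range M, ∑ j ∈ Finset.range M,
        min (-(2 * t) * (u i + u j) - 4 * t' * (u i * u j) - μ) 0 ≤ energyDensityTT' t t' U n := by
  have hMr : (0 : ℝ) < M := by exact_mod_cast hM
  have hπ := Real.pi_pos
  have hcM : ∀ l, l < 2 * M → (if l < M then l else 2 * M - 1 - l) < M := by
    intro l hl
    split_ifs <;> omega
  -- the cell-wise lower bound of the bathtub integrand
  have hgc : Continuous (Function.uncurry fun x y : ℝ =>
      min (2 * t * (Real.cos x + Real.cos y) - 4 * t' * (Real.cos x * Real.cos y) - μ) 0) := by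
    rw [Function.uncurry_def]
    fun_prop
  have hgrid := gridSum_le_integral_square hgc hM
    (fun l₁ l₂ => min (-(2 * t) * (u (if l₁ < M then l₁ else 2 * M - 1 - l₁) +
        u (if l₂ < M then l₂ else 2 * M - 1 - l₂)) - 4 * t' *
        (u (if l₁ < M then l₁ else 2 * M - 1 - l₁) * u (if l₂ < M then l₂ else 2 * M - 1 - l₂)) - μ) 0)
    (by
      intro l₁ hl₁ l₂ hl₂ x hx y hy
      have hA : -Real.cos x ≤ u (if l₁ < M then l₁ else 2 * M - 1 - l₁) :=
        (neg_cos_le_cos_foldedCell hM hl₁ hx.1 hx.2).trans (hu _ (hcM l₁ hl₁))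
      have hB : -Real.cos y ≤ u (if l₂ < M then l₂ else 2 * M - 1 - l₂) :=
        (neg_cos_le_cos_foldedCell hM hl₂ hy.1 hy.2).trans (hu _ (hcM l₂ hl₂))
      have key := min_shiftedBand_le htt' μ hA hB (by linarith [Real.cos_le_one x])
        (hu1 _ (hcM l₁ hl₁)) (by linarith [Real.cos_le_one y]) (by linarith [Real.neg_one_le_cos y])
      have hE : -(2 * t) * (-Real.cos x + -Real.cos y) - 4 * t' * (-Real.cos x * -Real.cos y) - μ =
          2 * t * (Real.cos x + Real.cos y) - 4 * t' * (Real.cos x * Real.cos y) - μ := by ring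
      rwa [hE] at key)
  -- fold the `2M × 2M` sum onto the `M × M` sum
  have hS : ∑ l₁ ∈ Finset.range (2 * M), ∑ l₂ ∈ Finset.range (2 * M),
      min (-(2 * t) * (u (if l₁ < M then l₁ else 2 * M - 1 - l₁) +
        u (if l₂ < M then l₂ else 2 * M - 1 - l₂)) - 4 * t' *
        (u (if l₁ < M then l₁ else 2 * M - 1 - l₁) * u (if l₂ < M then l₂ else 2 * M - 1 - l₂)) - μ) 0 =
      4 * ∑ i ∈ Finset.range M, ∑ j ∈ Finset.range M,
        min (-(2 * t) * (u i + u j) - 4 * t' * (u i * u j) - μ) 0 := by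
    have h1 : ∀ l₁ : ℕ, ∑ l₂ ∈ Finset.range (2 * M),
        min (-(2 * t) * (u (if l₁ < M then l₁ else 2 * M - 1 - l₁) +
          u (if l₂ < M then l₂ else 2 * M - 1 - l₂)) - 4 * t' *
          (u (if l₁ < M then l₁ else 2 * M - 1 - l₁) * u (if l₂ < M then l₂ else 2 * M - 1 - l₂)) - μ) 0 =
        2 * ∑ j ∈ Finset.range M, min (-(2 * t) * (u (if l₁ < M then l₁ else 2 * M - 1 - l₁) + u j) -
          4 * t' * (u (if l₁ < M then l₁ else 2 * M - 1 - l₁) * u j) - μ) 0 := by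
      intro l₁
      rw [sum_range_two_mul_foldedCell M fun j => min (-(2 * t) *
        (u (if l₁ < M then l₁ else 2 * M - 1 - l₁) + u j) -
        4 * t' * (u (if l₁ < M then l₁ else 2 * M - 1 - l₁) * u j) - μ) 0]
      ring
    rw [Finset.sum_congr rfl fun l₁ _ => h1 l₁, ← Finset.mul_sum]
    have h2 := sum_range_two_mul_foldedCell M fun i => ∑ j ∈ Finset.range M,
      min (-(2 * t) * (u i + u j) - 4 * t' * (u i * u j) - μ) 0
    rw [h2]
    ring
  -- the Brillouin-zone integral of the bathtub bound as the iterated integral over the square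
  have hbath := energyDensityTT'_ge_bathtub t t' hU hn0 hn2 μ
  have hsq : (∫ p in brillouin 2, min (2 * t * (Real.cos (p 0) + Real.cos (p 1)) -
      4 * t' * (Real.cos (p 0) * Real.cos (p 1)) - μ) 0) =
      ∫ x in (-π)..π, ∫ y in (-π)..π,
        min (2 * t * (Real.cos x + Real.cos y) - 4 * t' * (Real.cos x * Real.cos y) - μ) 0 := by
    have h := integral_brillouin_two_eq_integral_square'
      (fun q : ℝ × ℝ => min (2 * t * (Real.cos q.1 + Real.cos q.2) -
        4 * t' * (Real.cos q.1 * Real.cos q.2) - μ) 0)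
    dsimp only at h
    rw [h, integral_square_eq_iterated' (by fun_prop)]
  rw [hsq] at hbath
  rw [hS] at hgrid
  set S := ∑ i ∈ Finset.range M, ∑ j ∈ Finset.range M,
    min (-(2 * t) * (u i + u j) - 4 * t' * (u i * u j) - μ) 0 with hSdef
  calc μ * n + 2 / (M : ℝ) ^ 2 * S
        = μ * n + 2 * (((2 * Real.pi) ^ 2)⁻¹ * ((π / M) ^ 2 * (4 * S))) := by
          field_simp
          ring
    _ ≤ μ * n + 2 * (((2 * Real.pi) ^ 2)⁻¹ * ∫ x in (-π)..π, ∫ y in (-π)..π,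
          min (2 * t * (Real.cos x + Real.cos y) - 4 * t' * (Real.cos x * Real.cos y) - μ) 0) := by
          gcongr
    _ ≤ energyDensityTT' t t' U n := hbath

/-- **The `t = 1` form** used by the screening LP (`|t'| ≤ 1/2`): for `U ≥ 0`, `0 ≤ n < 2`, `M ≥ 1` and
numbers `cos(iπ/M) ≤ uᵢ ≤ 1` (`i < M`), every `μ`:
`μ n + 2 M⁻² Σ_{i,j<M} min(-2(uᵢ + uⱼ) - 4t' uᵢ uⱼ - μ, 0) ≤ e(1, t', U, n)` — planner-p2's
`bathtub-corner/1` inequality `ell ≤ e(1, t', 0, n)`, here for the whole repulsive family.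
[cite: LiebLoss1993, §8, Theorem 8.2] -/
theorem energyDensityTT'_one_ge_fermiSea_cornerSum (t' : ℝ) (ht' : |t'| ≤ 1 / 2) {U : ℝ} (hU : 0 ≤ U)
    {n : ℝ} (hn0 : 0 ≤ n) (hn2 : n < 2) {M : ℕ} (hM : 0 < M) (u : ℕ → ℝ)
    (hu : ∀ i < M, Real.cos (i * π / M) ≤ u i) (hu1 : ∀ i < M, u i ≤ 1) (μ : ℝ) :
    μ * n + 2 / (M : ℝ) ^ 2 * ∑ i ∈ Finset.range M, ∑ j ∈ Finset.range M,
        min (-2 * (u i + u j) - 4 * t' * (u i * u j) - μ) 0 ≤ energyDensityTT' 1 t' U n := by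
  have h := energyDensityTT'_ge_fermiSea_cornerSum 1 t' (by linarith) hU hn0 hn2 hM u hu hu1 μ
  simpa only [mul_one] using h

end FermiSeaCornerSum

/-! ### §6b Cell-exact Fermi-sea rows: interior cells integrated in closed form

The corner minorant of §6 is first order in the grid step (`≈ 3/M` at the screening densities). On a
cell lying entirely INSIDE the Fermi sea (`E ≤ μ` on the cell, certified at the far corner from any lower
bounds `wᵢ ≤ cos((i+1)π/M)`) the integrand `min(E - μ, 0)` IS `E - μ`, and its cell integral is
elementary: with `Sᵢ = sin((i+1)π/M) - sin(iπ/M)` and `Δ = π/M`,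
`∫∫_cell (E - μ) = -2tΔ(Sᵢ + Sⱼ) - 4t' Sᵢ Sⱼ - μΔ²` (the same value for both pre-images of a folded
cell). Using the exact value on the certified interior cells and the corner bound elsewhere gives

  `μ n + (2/π²) Σ_{i,j<M} cᵢⱼ ≤ e(t, t', U, n)`,
  `cᵢⱼ = -2tΔ(Sᵢ + Sⱼ) - 4t' Sᵢ Sⱼ - μΔ²` (interior) resp. `Δ² min(E(uᵢ, uⱼ) - μ, 0)` (otherwise)

(`energyDensityTT'_ge_fermiSea_cellSum`): only the `O(M)` cells met by the Fermi surface keep a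
first-order error, so the bound is second-order sharp in `1/M` (at `M = 128` it is tighter than the
`M = 4000` corner sum). The remaining inputs — cosine tables, an enclosure of the `Sᵢ` and of `π` — are
the user's (kernel rows: `HubbardFermiSeaCellRows`). -/

section FermiSeaCellSum

open Real Set MeasureTheory

/-- The shifted band `E(a, b) = -2t(a + b) - 4t' a b` is decreasing in each argument on `[-1, 1]²` when
`2|t'| ≤ t` (un-truncated form of `min_shiftedBand_le`). [folklore] -/
private theorem shiftedBand_le {t t' : ℝ} (htt' : 2 * |t'| ≤ t) {A B a' b' : ℝ}
    (hA : A ≤ a') (hB : B ≤ b') (hA1 : -1 ≤ A) (ha'1 : a' ≤ 1) (hB1 : -1 ≤ B) (hB1' : B ≤ 1) :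
    -(2 * t) * (a' + b') - 4 * t' * (a' * b') ≤ -(2 * t) * (A + B) - 4 * t' * (A * B) := by
  have h1 : 0 ≤ 2 * t + 4 * t' * B := by
    have h : -|t'| ≤ t' * B := by
      have h₁ := neg_abs_le (t' * B)
      have h₂ : |t' * B| ≤ |t'| := by
        rw [abs_mul]
        exact mul_le_of_le_one_right (abs_nonneg _) (abs_le.2 ⟨hB1, hB1'⟩)
      linarith
    linarith
  have h2 : 0 ≤ 2 * t + 4 * t' * a' := by
    have h : -|t'| ≤ t' * a' := by
      have h₁ := neg_abs_le (t' * a')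
      have h₂ : |t' * a'| ≤ |t'| := by
        rw [abs_mul]
        exact mul_le_of_le_one_right (abs_nonneg _) (abs_le.2 ⟨by linarith, ha'1⟩)
      linarith
    linarith
  nlinarith [mul_nonneg (sub_nonneg.2 hA) h1, mul_nonneg (sub_nonneg.2 hB) h2]

/-- Lower end of the folded cell: on the cell `-π + lπ/M ≤ x ≤ -π + (l+1)π/M` (`l < 2M`) the shifted
cosine `-cos x` is at least `cos((c+1)π/M)`, `c` the folded cell index. [folklore] -/
private theorem cos_foldedCell_succ_le_neg_cos {M l : ℕ} (hM : 0 < M) (hl : l < 2 * M) {x : ℝ}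
    (hx1 : -π + l * π / M ≤ x) (hx2 : x ≤ -π + (l + 1) * π / M) :
    Real.cos ((((if l < M then l else 2 * M - 1 - l : ℕ) : ℝ) + 1) * π / M) ≤ -Real.cos x := by
  have hMr : (0 : ℝ) < M := by exact_mod_cast hM
  have hπ := Real.pi_pos
  split_ifs with hlM
  · -- `x + π ∈ [lπ/M, (l+1)π/M] ⊆ [0, π]`
    rw [← Real.cos_add_pi]
    have hl1 : ((l : ℝ) + 1) * π / M ≤ π := by
      rw [div_le_iff₀ hMr]
      have h : (l : ℝ) + 1 ≤ M := by exact_mod_cast hlM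
      nlinarith
    have hl0 : 0 ≤ (l : ℝ) * π / M := by positivity
    exact Real.cos_le_cos_of_nonneg_of_le_pi (by linarith) hl1 (by linarith)
  · -- `π - x ∈ [(2M-1-l)π/M, (2M-l)π/M] ⊆ [0, π]`
    rw [not_lt] at hlM
    rw [← Real.cos_pi_sub]
    have hcast : ((2 * M - 1 - l : ℕ) : ℝ) = 2 * M - 1 - l := by
      rw [Nat.cast_sub (by omega), Nat.cast_sub (by omega)]
      push_cast
      ring
    rw [hcast]
    have h2Ml : 0 ≤ (2 * (M : ℝ) - 1 - l) * π / M := by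
      have h : (l : ℝ) + 1 ≤ 2 * M := by exact_mod_cast (show l + 1 ≤ 2 * M by omega)
      apply div_nonneg (mul_nonneg (by linarith) hπ.le) hMr.le
    have heq : (2 * (M : ℝ) - 1 - l + 1) * π / M = 2 * π - (l : ℝ) * π / M := by
      field_simp
      ring
    have hle : (2 * (M : ℝ) - 1 - l + 1) * π / M ≤ π := by
      rw [heq]
      have hMl : π ≤ (l : ℝ) * π / M := by
        rw [le_div_iff₀ hMr]
        have h : (M : ℝ) ≤ l := by exact_mod_cast hlM
        nlinarith
      linarith
    have heq' : (2 * (M : ℝ) - 1 - l) * π / M = 2 * π - ((l : ℝ) + 1) * π / M := by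
      field_simp
      ring
    refine Real.cos_le_cos_of_nonneg_of_le_pi ?_ hle ?_
    · have : π - x ≥ (2 * (M : ℝ) - 1 - l) * π / M := by rw [heq']; linarith
      linarith
    · rw [heq]; linarith

/-- `∫_α^β (A + B cos y) dy = A(β - α) + B(sin β - sin α)`. [folklore] -/
private theorem integral_const_add_mul_cos (A B α β : ℝ) :
    ∫ y in α..β, (A + B * Real.cos y) = A * (β - α) + B * (Real.sin β - Real.sin α) := by
  have h1 : IntervalIntegrable (fun _ : ℝ => A) MeasureTheory.volume α β := intervalIntegrable_const
  have h2 : IntervalIntegrable (fun y : ℝ => B * Real.cos y) MeasureTheory.volume α β :=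
    (Real.continuous_cos.const_mul B).intervalIntegrable _ _
  rw [intervalIntegral.integral_add h1 h2, intervalIntegral.integral_const, intervalIntegral.integral_const_mul,
    integral_cos, smul_eq_mul]
  ring

/-- The band integrated over a rectangle in closed form:
`∫_α^β ∫_γ^δ (2t(cos x + cos y) - 4t' cos x cos y - μ) dy dx
 = 2t(δ-γ)(sin β - sin α) + 2t(β-α)(sin δ - sin γ) - 4t'(sin β - sin α)(sin δ - sin γ) - μ(β-α)(δ-γ)`.
[folklore] -/
private theorem cellIntegral_band (t t' μ α β γ δ : ℝ) :
    ∫ x in α..β, ∫ y in γ..δ,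
        (2 * t * (Real.cos x + Real.cos y) - 4 * t' * (Real.cos x * Real.cos y) - μ) =
      2 * t * (δ - γ) * (Real.sin β - Real.sin α) + 2 * t * (β - α) * (Real.sin δ - Real.sin γ) -
        4 * t' * ((Real.sin β - Real.sin α) * (Real.sin δ - Real.sin γ)) - μ * ((β - α) * (δ - γ)) := by
  have inner : (fun x => ∫ y in γ..δ,
      (2 * t * (Real.cos x + Real.cos y) - 4 * t' * (Real.cos x * Real.cos y) - μ)) =
      fun x => (-(μ * (δ - γ)) + 2 * t * (Real.sin δ - Real.sin γ)) +
        (2 * t * (δ - γ) - 4 * t' * (Real.sin δ - Real.sin γ)) * Real.cos x := by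
    funext x
    have h := integral_const_add_mul_cos (2 * t * Real.cos x - μ) (2 * t - 4 * t' * Real.cos x) γ δ
    have hc : (∫ y in γ..δ, (2 * t * (Real.cos x + Real.cos y) - 4 * t' * (Real.cos x * Real.cos y) - μ)) =
        ∫ y in γ..δ, (2 * t * Real.cos x - μ + (2 * t - 4 * t' * Real.cos x) * Real.cos y) :=
      intervalIntegral.integral_congr fun y _ => by ring
    rw [hc, h]
    ring
  rw [inner, integral_const_add_mul_cos]
  ring

/-- The sine increments of the two pre-images of a folded cell agree up to sign with the folded one:
for `a(l) = -π + lπ/M`, `sin(a(l+1)) - sin(a(l)) = -(sin((c+1)π/M) - sin(cπ/M))`, `c` the folded index.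
[folklore] -/
private theorem sin_sub_sin_foldedCell {M l : ℕ} (hM : 0 < M) (hl : l < 2 * M) :
    Real.sin (-π + ((l : ℝ) + 1) * π / M) - Real.sin (-π + (l : ℝ) * π / M) =
      -(Real.sin ((((if l < M then l else 2 * M - 1 - l : ℕ) : ℝ) + 1) * π / M) -
        Real.sin (((if l < M then l else 2 * M - 1 - l : ℕ) : ℝ) * π / M)) := by
  have hMr : (0 : ℝ) < M := by exact_mod_cast hM
  split_ifs with hlM
  · rw [show -π + ((l : ℝ) + 1) * π / M = ((l : ℝ) + 1) * π / M - π by ring,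
      show -π + (l : ℝ) * π / M = (l : ℝ) * π / M - π by ring, Real.sin_sub_pi, Real.sin_sub_pi]
    ring
  · rw [not_lt] at hlM
    have hcast : ((2 * M - 1 - l : ℕ) : ℝ) = 2 * M - 1 - l := by
      rw [Nat.cast_sub (by omega), Nat.cast_sub (by omega)]
      push_cast
      ring
    rw [hcast,
      show -π + ((l : ℝ) + 1) * π / M = π - (2 * (M : ℝ) - 1 - l) * π / M by field_simp; ring,
      show -π + (l : ℝ) * π / M = π - (2 * (M : ℝ) - 1 - l + 1) * π / M by field_simp; ring,
      Real.sin_pi_sub, Real.sin_pi_sub]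
    ring

/-- **Cell sums under the double integral**: lower bounds `B l₁ l₂` of the CELL INTEGRALS of a
continuous `g` over the `2M × 2M` uniform cells of `[-π, π]²` add up to a lower bound of
`∫_{-π}^{π}∫_{-π}^{π} g` (refines `gridSum_le_integral_square`, whose bounds are pointwise). [folklore] -/
private theorem cellSum_le_integral_square {g : ℝ → ℝ → ℝ} (hg : Continuous (Function.uncurry g))
    {M : ℕ} (hM : 0 < M) (B : ℕ → ℕ → ℝ)
    (hB : ∀ l₁, l₁ < 2 * M → ∀ l₂, l₂ < 2 * M →
      B l₁ l₂ ≤ ∫ x in (-π + l₁ * π / M)..(-π + (l₁ + 1) * π / M),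
        ∫ y in (-π + l₂ * π / M)..(-π + (l₂ + 1) * π / M), g x y) :
    ∑ l₁ ∈ Finset.range (2 * M), ∑ l₂ ∈ Finset.range (2 * M), B l₁ l₂ ≤
      ∫ x in (-π)..π, ∫ y in (-π)..π, g x y := by
  have hMr : (0 : ℝ) < M := by exact_mod_cast hM
  have hπ := Real.pi_pos
  set a : ℕ → ℝ := fun l => -π + l * π / M with ha
  have ha0 : a 0 = -π := by simp [ha]
  have ha2M : a (2 * M) = π := by
    simp only [ha]
    push_cast
    field_simp
    ring
  have haS : ∀ l : ℕ, a (l + 1) = -π + ((l : ℝ) + 1) * π / M := fun l => by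
    simp only [ha, Nat.cast_add_one]
  have hgx : ∀ x, Continuous (g x) := fun x => hg.uncurry_left x
  -- `x ↦ ∫_{cell l₂} g x y dy` is continuous
  have hFl : ∀ l₂ : ℕ, Continuous fun x => ∫ y in (a l₂)..(a (l₂ + 1)), g x y := fun l₂ =>
    intervalIntegral.continuous_parametric_intervalIntegral_of_continuous' hg _ _
  have hF : Continuous fun x => ∫ y in (-π)..π, g x y :=
    intervalIntegral.continuous_parametric_intervalIntegral_of_continuous' hg (-π) π
  -- split the inner integral on every `x`
  have hinner : ∀ x, ∫ y in (-π)..π, g x y = ∑ l₂ ∈ Finset.range (2 * M), ∫ y in (a l₂)..(a (l₂ + 1)), g x y := by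
    intro x
    rw [intervalIntegral.sum_integral_adjacent_intervals fun k _ => (hgx x).intervalIntegrable _ _, ha0, ha2M]
  -- split the outer integral
  have hsplit : ∫ x in (-π)..π, ∫ y in (-π)..π, g x y =
      ∑ l₁ ∈ Finset.range (2 * M), ∫ x in (a l₁)..(a (l₁ + 1)), ∫ y in (-π)..π, g x y := by
    rw [intervalIntegral.sum_integral_adjacent_intervals fun k _ => hF.intervalIntegrable _ _, ha0, ha2M]
  rw [hsplit]
  refine Finset.sum_le_sum fun l₁ hl₁ => ?_
  rw [Finset.mem_range] at hl₁
  have hswap : ∫ x in (a l₁)..(a (l₁ + 1)), ∫ y in (-π)..π, g x y =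
      ∑ l₂ ∈ Finset.range (2 * M), ∫ x in (a l₁)..(a (l₁ + 1)), ∫ y in (a l₂)..(a (l₂ + 1)), g x y := by
    rw [← intervalIntegral.integral_finsetSum fun l₂ _ => (hFl l₂).intervalIntegrable _ _]
    exact intervalIntegral.integral_congr fun x _ => hinner x
  rw [hswap]
  refine Finset.sum_le_sum fun l₂ hl₂ => ?_
  rw [Finset.mem_range] at hl₂
  have h := hB l₁ hl₁ l₂ hl₂
  rw [← haS l₁, ← haS l₂] at h
  exact h

/-- A pointwise constant lower bound on a cell integrates to `Δ² c`. [folklore] -/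
private theorem sq_mul_le_cellIntegral {g : ℝ → ℝ → ℝ} (hg : Continuous (Function.uncurry g))
    {α β γ δ c : ℝ} (hαβ : α ≤ β) (hγδ : γ ≤ δ)
    (h : ∀ x ∈ Icc α β, ∀ y ∈ Icc γ δ, c ≤ g x y) :
    (β - α) * (δ - γ) * c ≤ ∫ x in α..β, ∫ y in γ..δ, g x y := by
  have hgx : ∀ x, Continuous (g x) := fun x => hg.uncurry_left x
  have hF : Continuous fun x => ∫ y in γ..δ, g x y :=
    intervalIntegral.continuous_parametric_intervalIntegral_of_continuous' hg _ _
  have hin : ∀ x ∈ Icc α β, (δ - γ) * c ≤ ∫ y in γ..δ, g x y := by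
    intro x hx
    calc (δ - γ) * c = ∫ _ in γ..δ, c := by rw [intervalIntegral.integral_const, smul_eq_mul]
      _ ≤ ∫ y in γ..δ, g x y :=
          intervalIntegral.integral_mono_on hγδ intervalIntegrable_const ((hgx x).intervalIntegrable _ _)
            fun y hy => h x hx y hy
  calc (β - α) * (δ - γ) * c = ∫ _ in α..β, (δ - γ) * c := by
        rw [intervalIntegral.integral_const, smul_eq_mul]; ring
    _ ≤ ∫ x in α..β, ∫ y in γ..δ, g x y :=
        intervalIntegral.integral_mono_on hαβ intervalIntegrable_const (hF.intervalIntegrable _ _) hin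

/-- **Cell-exact Fermi-sea bound.** Let `2|t'| ≤ t`, `U ≥ 0`, `0 ≤ n < 2`, `M ≥ 1`; let `uᵢ ≥ cos(iπ/M)`
with `uᵢ ≤ 1` and `-1 ≤ wᵢ ≤ cos((i+1)π/M)` (`i < M`) be any tables, `μ` any chemical potential, and let
`ins i j` flag cells CERTIFIED INTERIOR: `ins i j = true → -2t(wᵢ + wⱼ) - 4t' wᵢ wⱼ ≤ μ` (so that
`E ≤ μ` on the whole cell, `E(a,b) = -2t(a+b) - 4t'ab` being decreasing in each argument). Then, with
`Sᵢ = sin((i+1)π/M) - sin(iπ/M)` and `Δ = π/M`,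

  `μ n + (2/π²) Σ_{i,j<M} cᵢⱼ ≤ e(t, t', U, n)`,
  `cᵢⱼ = -2tΔ(Sᵢ + Sⱼ) - 4t' SᵢSⱼ - μΔ²` if `ins i j`, else `Δ² · min(-2t(uᵢ + uⱼ) - 4t' uᵢuⱼ - μ, 0)`:

on a flagged cell the integrand `min(E - μ, 0)` of `energyDensityTT'_ge_bathtub` equals `E - μ` and is
integrated in closed form (`∫_cell cos = -Sᵢ` on both pre-images of the folded cell), elsewhere the
corner bound of `energyDensityTT'_ge_fermiSea_cornerSum` is used. With `ins ≡ false` this is that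
theorem (`(2/π²)Δ² = 2/M²`). [cite: LiebLoss1993, §8, Theorem 8.2] -/
theorem energyDensityTT'_ge_fermiSea_cellSum (t t' : ℝ) (htt' : 2 * |t'| ≤ t) {U : ℝ} (hU : 0 ≤ U)
    {n : ℝ} (hn0 : 0 ≤ n) (hn2 : n < 2) {M : ℕ} (hM : 0 < M) (u w : ℕ → ℝ)
    (hu : ∀ i < M, Real.cos (i * π / M) ≤ u i) (hu1 : ∀ i < M, u i ≤ 1)
    (hw : ∀ i < M, w i ≤ Real.cos (((i : ℝ) + 1) * π / M)) (hw1 : ∀ i < M, -1 ≤ w i)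
    (μ : ℝ) (ins : ℕ → ℕ → Bool)
    (hins : ∀ i < M, ∀ j < M, ins i j = true → -(2 * t) * (w i + w j) - 4 * t' * (w i * w j) ≤ μ) :
    μ * n + 2 / π ^ 2 * ∑ i ∈ Finset.range M, ∑ j ∈ Finset.range M,
        (if ins i j then
          -(2 * t) * (π / M) * ((Real.sin (((i : ℝ) + 1) * π / M) - Real.sin (i * π / M)) +
              (Real.sin (((j : ℝ) + 1) * π / M) - Real.sin (j * π / M))) -
            4 * t' * ((Real.sin (((i : ℝ) + 1) * π / M) - Real.sin (i * π / M)) *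
              (Real.sin (((j : ℝ) + 1) * π / M) - Real.sin (j * π / M))) -
            μ * (π / M) ^ 2
        else (π / M) ^ 2 * min (-(2 * t) * (u i + u j) - 4 * t' * (u i * u j) - μ) 0) ≤
      energyDensityTT' t t' U n := by
  have hMr : (0 : ℝ) < M := by exact_mod_cast hM
  have hπ := Real.pi_pos
  have hΔ : 0 < π / M := by positivity
  -- folded index and the cell value as a function of the folded indices
  set c : ℕ → ℕ := fun l => if l < M then l else 2 * M - 1 - l with hcdef
  have hcM : ∀ l, l < 2 * M → c l < M := by
    intro l hl
    simp only [hcdef]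
    split_ifs <;> omega
  set S : ℕ → ℝ := fun i => Real.sin (((i : ℝ) + 1) * π / M) - Real.sin (i * π / M) with hSdef
  set C : ℕ → ℕ → ℝ := fun i j =>
    if ins i j then -(2 * t) * (π / M) * (S i + S j) - 4 * t' * (S i * S j) - μ * (π / M) ^ 2
    else (π / M) ^ 2 * min (-(2 * t) * (u i + u j) - 4 * t' * (u i * u j) - μ) 0 with hCdef
  -- the integrand
  set G : ℝ → ℝ → ℝ := fun x y =>
    min (2 * t * (Real.cos x + Real.cos y) - 4 * t' * (Real.cos x * Real.cos y) - μ) 0 with hGdef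
  have hgc : Continuous (Function.uncurry G) := by
    rw [hGdef, Function.uncurry_def]
    fun_prop
  have hgc' : Continuous (Function.uncurry fun x y : ℝ =>
      2 * t * (Real.cos x + Real.cos y) - 4 * t' * (Real.cos x * Real.cos y) - μ) := by
    rw [Function.uncurry_def]
    fun_prop
  -- the cell bound
  have hcell : ∀ l₁, l₁ < 2 * M → ∀ l₂, l₂ < 2 * M →
      C (c l₁) (c l₂) ≤ ∫ x in (-π + l₁ * π / M)..(-π + (l₁ + 1) * π / M),
        ∫ y in (-π + l₂ * π / M)..(-π + (l₂ + 1) * π / M), G x y := by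
    intro l₁ hl₁ l₂ hl₂
    have hα : -π + (l₁ : ℝ) * π / M ≤ -π + ((l₁ : ℝ) + 1) * π / M := by
      have : (l₁ : ℝ) * π / M ≤ ((l₁ : ℝ) + 1) * π / M := by gcongr; linarith
      linarith
    have hγ : -π + (l₂ : ℝ) * π / M ≤ -π + ((l₂ : ℝ) + 1) * π / M := by
      have : (l₂ : ℝ) * π / M ≤ ((l₂ : ℝ) + 1) * π / M := by gcongr; linarith
      linarith
    simp only [hCdef]
    by_cases hin : ins (c l₁) (c l₂) = true
    · -- interior cell: `G = E - μ` on the cell, integrate exactly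
      rw [if_pos hin]
      have hEμ : ∀ x ∈ Icc (-π + (l₁ : ℝ) * π / M) (-π + ((l₁ : ℝ) + 1) * π / M),
          ∀ y ∈ Icc (-π + (l₂ : ℝ) * π / M) (-π + ((l₂ : ℝ) + 1) * π / M),
          2 * t * (Real.cos x + Real.cos y) - 4 * t' * (Real.cos x * Real.cos y) - μ ≤ 0 := by
        intro x hx y hy
        have hA : w (c l₁) ≤ -Real.cos x :=
          (hw _ (hcM l₁ hl₁)).trans (cos_foldedCell_succ_le_neg_cos hM hl₁ hx.1 hx.2)
        have hB : w (c l₂) ≤ -Real.cos y :=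
          (hw _ (hcM l₂ hl₂)).trans (cos_foldedCell_succ_le_neg_cos hM hl₂ hy.1 hy.2)
        have hB1' : w (c l₂) ≤ 1 := (hw _ (hcM l₂ hl₂)).trans (Real.cos_le_one _)
        have key := shiftedBand_le htt' hA hB (hw1 _ (hcM l₁ hl₁))
          (by linarith [Real.neg_one_le_cos x]) (hw1 _ (hcM l₂ hl₂)) hB1'
        have hE : -(2 * t) * (-Real.cos x + -Real.cos y) - 4 * t' * (-Real.cos x * -Real.cos y) =
            2 * t * (Real.cos x + Real.cos y) - 4 * t' * (Real.cos x * Real.cos y) := by ring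
        rw [hE] at key
        linarith [hins _ (hcM l₁ hl₁) _ (hcM l₂ hl₂) hin]
      have hGE : ∫ x in (-π + (l₁ : ℝ) * π / M)..(-π + ((l₁ : ℝ) + 1) * π / M),
          ∫ y in (-π + (l₂ : ℝ) * π / M)..(-π + ((l₂ : ℝ) + 1) * π / M), G x y =
          ∫ x in (-π + (l₁ : ℝ) * π / M)..(-π + ((l₁ : ℝ) + 1) * π / M),
          ∫ y in (-π + (l₂ : ℝ) * π / M)..(-π + ((l₂ : ℝ) + 1) * π / M),
            (2 * t * (Real.cos x + Real.cos y) - 4 * t' * (Real.cos x * Real.cos y) - μ) := by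
        refine intervalIntegral.integral_congr fun x hx => ?_
        rw [uIcc_of_le hα] at hx
        refine intervalIntegral.integral_congr fun y hy => ?_
        rw [uIcc_of_le hγ] at hy
        simp only [hGdef]
        exact min_eq_left (hEμ x hx y hy)
      rw [hGE, cellIntegral_band, sin_sub_sin_foldedCell hM hl₁, sin_sub_sin_foldedCell hM hl₂]
      simp only [hSdef, hcdef]
      have hΔ₁ : -π + ((l₁ : ℝ) + 1) * π / M - (-π + (l₁ : ℝ) * π / M) = π / M := by
        field_simp; ring
      have hΔ₂ : -π + ((l₂ : ℝ) + 1) * π / M - (-π + (l₂ : ℝ) * π / M) = π / M := by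
        field_simp; ring
      rw [hΔ₁, hΔ₂]
      apply le_of_eq
      ring
    · -- other cell: the corner bound, integrated
      rw [if_neg hin]
      have hpt : ∀ x ∈ Icc (-π + (l₁ : ℝ) * π / M) (-π + ((l₁ : ℝ) + 1) * π / M),
          ∀ y ∈ Icc (-π + (l₂ : ℝ) * π / M) (-π + ((l₂ : ℝ) + 1) * π / M),
          min (-(2 * t) * (u (c l₁) + u (c l₂)) - 4 * t' * (u (c l₁) * u (c l₂)) - μ) 0 ≤ G x y := by
        intro x hx y hy
        have hA : -Real.cos x ≤ u (c l₁) :=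
          (neg_cos_le_cos_foldedCell hM hl₁ hx.1 hx.2).trans (hu _ (hcM l₁ hl₁))
        have hB : -Real.cos y ≤ u (c l₂) :=
          (neg_cos_le_cos_foldedCell hM hl₂ hy.1 hy.2).trans (hu _ (hcM l₂ hl₂))
        have key := min_shiftedBand_le htt' μ hA hB (by linarith [Real.cos_le_one x])
          (hu1 _ (hcM l₁ hl₁)) (by linarith [Real.cos_le_one y]) (by linarith [Real.neg_one_le_cos y])
        have hE : -(2 * t) * (-Real.cos x + -Real.cos y) - 4 * t' * (-Real.cos x * -Real.cos y) - μ =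
            2 * t * (Real.cos x + Real.cos y) - 4 * t' * (Real.cos x * Real.cos y) - μ := by ring
        rw [hE] at key
        simpa only [hGdef] using key
      have h := sq_mul_le_cellIntegral hgc hα hγ hpt
      have hΔ₁ : -π + ((l₁ : ℝ) + 1) * π / M - (-π + (l₁ : ℝ) * π / M) = π / M := by
        field_simp; ring
      have hΔ₂ : -π + ((l₂ : ℝ) + 1) * π / M - (-π + (l₂ : ℝ) * π / M) = π / M := by
        field_simp; ring
      rw [hΔ₁, hΔ₂, ← sq] at h
      exact h
  have hgrid := cellSum_le_integral_square hgc hM (fun l₁ l₂ => C (c l₁) (c l₂)) hcell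
  -- fold the `2M × 2M` sum onto the `M × M` sum
  have hS : ∑ l₁ ∈ Finset.range (2 * M), ∑ l₂ ∈ Finset.range (2 * M), C (c l₁) (c l₂) =
      4 * ∑ i ∈ Finset.range M, ∑ j ∈ Finset.range M, C i j := by
    have h1 : ∀ l₁ : ℕ, ∑ l₂ ∈ Finset.range (2 * M), C (c l₁) (c l₂) =
        2 * ∑ j ∈ Finset.range M, C (c l₁) j := by
      intro l₁
      have h := sum_range_two_mul_foldedCell M fun j => C (c l₁) j
      simp only [hcdef] at h ⊢
      rw [h]
      ring
    rw [Finset.sum_congr rfl fun l₁ _ => h1 l₁, ← Finset.mul_sum]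
    have h2 := sum_range_two_mul_foldedCell M fun i => ∑ j ∈ Finset.range M, C i j
    simp only [hcdef] at h2 ⊢
    rw [h2]
    ring
  -- the bathtub bound as the iterated integral over the square
  have hbath := energyDensityTT'_ge_bathtub t t' hU hn0 hn2 μ
  have hsq : (∫ p in brillouin 2, min (2 * t * (Real.cos (p 0) + Real.cos (p 1)) -
      4 * t' * (Real.cos (p 0) * Real.cos (p 1)) - μ) 0) = ∫ x in (-π)..π, ∫ y in (-π)..π, G x y := by
    have h := integral_brillouin_two_eq_integral_square'
      (fun q : ℝ × ℝ => min (2 * t * (Real.cos q.1 + Real.cos q.2) -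
        4 * t' * (Real.cos q.1 * Real.cos q.2) - μ) 0)
    dsimp only at h
    rw [h, integral_square_eq_iterated' (by fun_prop)]
  rw [hsq] at hbath
  rw [hS] at hgrid
  -- the statement's sum is `Σ C i j`
  have hsum : ∑ i ∈ Finset.range M, ∑ j ∈ Finset.range M,
      (if ins i j then
          -(2 * t) * (π / M) * ((Real.sin (((i : ℝ) + 1) * π / M) - Real.sin (i * π / M)) +
              (Real.sin (((j : ℝ) + 1) * π / M) - Real.sin (j * π / M))) -
            4 * t' * ((Real.sin (((i : ℝ) + 1) * π / M) - Real.sin (i * π / M)) *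
              (Real.sin (((j : ℝ) + 1) * π / M) - Real.sin (j * π / M))) -
            μ * (π / M) ^ 2
        else (π / M) ^ 2 * min (-(2 * t) * (u i + u j) - 4 * t' * (u i * u j) - μ) 0) =
      ∑ i ∈ Finset.range M, ∑ j ∈ Finset.range M, C i j := by
    simp only [hCdef, hSdef]
  rw [hsum]
  set T := ∑ i ∈ Finset.range M, ∑ j ∈ Finset.range M, C i j with hTdef
  calc μ * n + 2 / π ^ 2 * T
        = μ * n + 2 * (((2 * Real.pi) ^ 2)⁻¹ * (4 * T)) := by
          field_simp
          ring
    _ ≤ μ * n + 2 * (((2 * Real.pi) ^ 2)⁻¹ * ∫ x in (-π)..π, ∫ y in (-π)..π, G x y) := by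
          gcongr
    _ ≤ energyDensityTT' t t' U n := hbath

/-- **The `t = 1` form** for the screening LP (`|t'| ≤ 1/2`); see `energyDensityTT'_ge_fermiSea_cellSum`.
[cite: LiebLoss1993, §8, Theorem 8.2] -/
theorem energyDensityTT'_one_ge_fermiSea_cellSum (t' : ℝ) (ht' : |t'| ≤ 1 / 2) {U : ℝ} (hU : 0 ≤ U)
    {n : ℝ} (hn0 : 0 ≤ n) (hn2 : n < 2) {M : ℕ} (hM : 0 < M) (u w : ℕ → ℝ)
    (hu : ∀ i < M, Real.cos (i * π / M) ≤ u i) (hu1 : ∀ i < M, u i ≤ 1)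
    (hw : ∀ i < M, w i ≤ Real.cos (((i : ℝ) + 1) * π / M)) (hw1 : ∀ i < M, -1 ≤ w i)
    (μ : ℝ) (ins : ℕ → ℕ → Bool)
    (hins : ∀ i < M, ∀ j < M, ins i j = true → -2 * (w i + w j) - 4 * t' * (w i * w j) ≤ μ) :
    μ * n + 2 / π ^ 2 * ∑ i ∈ Finset.range M, ∑ j ∈ Finset.range M,
        (if ins i j then
          -2 * (π / M) * ((Real.sin (((i : ℝ) + 1) * π / M) - Real.sin (i * π / M)) +
              (Real.sin (((j : ℝ) + 1) * π / M) - Real.sin (j * π / M))) -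
            4 * t' * ((Real.sin (((i : ℝ) + 1) * π / M) - Real.sin (i * π / M)) *
              (Real.sin (((j : ℝ) + 1) * π / M) - Real.sin (j * π / M))) -
            μ * (π / M) ^ 2
        else (π / M) ^ 2 * min (-2 * (u i + u j) - 4 * t' * (u i * u j) - μ) 0) ≤
      energyDensityTT' 1 t' U n := by
  have h := energyDensityTT'_ge_fermiSea_cellSum 1 t' (by linarith) hU hn0 hn2 hM u w hu hu1 hw hw1 μ ins
    (fun i hi j hj hij => by have := hins i hi j hj hij; linarith)
  simpa only [mul_one] using h

end FermiSeaCellSum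

end Literature.MathematicalPhysics.QuantumLattice
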